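import Literature.NumberTheory.Sieve.RosserSieveInduction
import Literature.NumberTheory.Sieve.RosserSieveRecurrencesBetaOne
import HarnessLib

/-!
# Rosser's sieve: the induction for the main term at `β = 1` (the half-dimensional sieve)

Topic `Literature/NumberTheory/Sieve`; Iwaniec, *Rosser's sieve*, Acta Arith. 36 (1980), §8, Lemma 20 for
`κ ≤ 1/2` (`β = 1`). This file PROVES the `β = 1`, `κ = 1/2` analogue of `RosserSieveInduction.lean` (which
treats `β > 1`): the induction on the number of boundary terms behind the main-term bound (8.1), with loss
exponent `e = 3/8`, amplitudes `6N(1 + ε)^{2N}`, and an abstract majorant package `H^±` (supplied by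
`RosserSieveBetaOneMajorants.exists_majorant_package_one`). Two features are specific to `β = 1`
(Iwaniec, p. 199, (8.8)–(8.9)):

* in the lower-parity recursion the primes `p ≥ y/2` (level `y/p ≤ 2`, where `T⁺(y/p, P(p)) = 1 − V(P(p)) ≤ 1`)
  are split off and bounded by `∑_{y/2 ≤ p < z} g(p) = O(1/log y)` — Iwaniec's condition `2p < y` in (8.8);
* for the remaining primes the weight `(1 − 1/t)^{−κ}` of the partial summation is capped at
  `t ≥ s₁ = log y/log(y/2)`, where `1 − 1/s₁ = log 2/log y`, giving the factor `(log y/log 2)^{κ}` of (8.9)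
  ("`(1 − 1/s₁)^{−κ} ≪ (log y)^{1/2}`"); to afford it the truncation level is `z₀ = exp((log y)^{19/20})`
  (`s₀ = (log y)^{1/20}`; Iwaniec: `s₀ = (log y)^{1/50} (log log y)^{3/50}`) instead of `e^{√(log y)}`.

## Contents (all PROVED; no definitions)

* `discT_one_le_one_of_level_le_four` (`T⁺(D, P(z)) ≤ 1` for `D ≤ 4`, `β = 1`), `sum_primes_g_le`
  (`∑_{w ≤ p < z} g(p) ≤ κ log(log z/log w) + L/log w` under `Ω(κ, L)`), `level_facts_one`,
  `vprod_trunc_le_one`, `discT_trunc_le_one` (Rankin at `z₀ = exp((log y)^{19/20})`);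
* `step_zero_one`, `step_one_high_one`, `step_one_low_one`, `small_level_one`, `amp_facts_one`,
  `claims_all_one` — the `β = 1` copies of the steps and of the induction of `RosserSieveInduction`.

## References

* H. Iwaniec, *Rosser's sieve*, Acta Arith. 36 (1980), 171–202: §8, Lemma 20, (8.1)–(8.14) (esp. (8.8)–(8.9)
  for `κ ≤ 1/2`); (4.4)–(4.6), (7.3). [IwaniecActaArith1980]
-/

open Finset Filter Set MeasureTheory intervalIntegral
open scoped ArithmeticFunction.Moebius ArithmeticFunction.omega Topology

noncomputable section

namespace Literature.NumberTheory.Sieve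

namespace BetaSieve

open BetaSieveForward (sieveKernel sieveKernel_nonneg continuousOn_sieveKernel)

variable {g : ArithmeticFunction ℝ} {κ L : ℝ}

/-! ### The upper sums at levels `≤ 4` and small sifting ranges (`β = 1`) -/

/-- `P(z) = 1` for `z ≤ 2`. [folklore] -/
theorem primesProdBelow_eq_one_of_le_two {z : ℝ} (hz : z ≤ 2) : primesProdBelow z = 1 :=
  Nat.dvd_one.mp (SieveSequence.primesProdBelow_two ▸ SieveSequence.primesProdBelow_dvd hz)

/-- All the sums `T_n(D, 1)` vanish (`χ̄(1) = 0`). [folklore] -/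
theorem discT_one_right (par : ℕ) (g : ArithmeticFunction ℝ) (β D : ℝ) (N : ℕ) : discT par g β D 1 N = 0 := by
  refine Finset.sum_eq_zero fun n _ => Finset.sum_eq_zero fun t ht => ?_
  rw [Finset.mem_filter, Nat.divisors_one, Finset.mem_singleton] at ht
  rw [ht.1, bdry_one, zero_mul, zero_mul]

/-- `∑_{n ≤ N} T_n(D, P) ≤ ∑_{n ≤ ν(P)} T_n(D, P)` (the terms are nonnegative and vanish beyond `ν(P)`).
[folklore] -/
theorem discT_le_discT_card (hg : g.IsMultiplicative) {P : ℕ} (hP : Squarefree P)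
    (h01 : ∀ p ∈ P.primeFactors, 0 ≤ g p ∧ g p ≤ 1) (par : ℕ) (β D : ℝ) (N : ℕ) :
    discT par g β D P N ≤ discT par g β D P P.primeFactors.card := by
  rcases le_or_gt P.primeFactors.card N with h | h
  · exact (discT_eq_of_le hP.ne_zero par β D h).le
  · rw [discT, discT, ← Finset.sum_range_add_sum_Ico _ (Nat.succ_le_succ h.le)]
    have : 0 ≤ ∑ n ∈ Finset.Ico (N + 1) (P.primeFactors.card + 1), bdrySum par g β D P n :=
      Finset.sum_nonneg fun n _ => bdrySum_nonneg hg hP h01 par β D n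
    linarith

/-- **The upper sums at a level `D ≤ 4` are at most `1`** (`β = 1`): `χ⁺(d) = 1` forces all prime factors of
`d` below `D^{1/2} ≤ 2`, so `S⁺(D, P(z)) = S⁺(D, 1) = 1` and `∑_n T⁺_n(D, P(z)) = S⁺ − V(P(z)) ≤ 1`
(Iwaniec's remark that only `2p < y` matters in (8.8): at level `y/p ≤ 2` the upper sum is trivial).
[cite: IwaniecActaArith1980, §8 (8.8)] -/
theorem discT_one_le_one_of_level_le_four (hg : g.IsMultiplicative)
    (h01 : ∀ p : ℕ, p.Prime → 0 ≤ g p ∧ g p < 1) {D : ℝ} (hD0 : 0 < D) (hD4 : D ≤ 4) (z : ℝ) (N : ℕ) :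
    discT 1 g 1 D (primesProdBelow z) N ≤ 1 := by
  set z' := D ^ (1 / ((1:ℝ) + 1)) with hz'
  have hz'0 : 0 < z' := Real.rpow_pos_of_pos hD0 _
  have hz'2 : z' ≤ 2 := by
    rw [hz', show (1 / ((1:ℝ) + 1)) = (1:ℝ) / 2 by norm_num]
    calc D ^ ((1:ℝ) / 2) ≤ (4:ℝ) ^ ((1:ℝ) / 2) := Real.rpow_le_rpow hD0.le hD4 (by norm_num)
      _ = 2 := by
          rw [show (4:ℝ) = 2 ^ (2:ℝ) by norm_num, ← Real.rpow_mul (by norm_num)]; norm_num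
  have hPz' : primesProdBelow z' = 1 := primesProdBelow_eq_one_of_le_two hz'2
  rcases le_or_gt z' z with hzz | hzz
  · set P := primesProdBelow z with hP
    have hPsq : Squarefree P := squarefree_primesProdBelow z
    have h01' : ∀ p ∈ P.primeFactors, 0 ≤ g p ∧ g p ≤ 1 := fun p hp =>
      ⟨(h01 p (Nat.prime_of_mem_primeFactors hp)).1, (h01 p (Nat.prime_of_mem_primeFactors hp)).2.le⟩
    refine (discT_le_discT_card hg hPsq h01' 1 1 D N).trans ?_
    have hmain := mainSum_eq_vprod_sub_discT hg hPsq 1 1 D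
    have hlevel : mainSum 1 g 1 D P = 1 := by
      rw [hP, mainSum_one_eq_of_level_le zero_le_one g hz'0 hzz (by
        rw [hz', ← Real.rpow_mul hD0.le]; norm_num), hPz', mainSum_one hg]
    have hV : 0 ≤ vprod g P :=
      Finset.prod_nonneg fun p hp => sub_nonneg.mpr (h01 p (Nat.prime_of_mem_primeFactors hp)).2.le
    rw [pow_one] at hmain
    linarith
  · rw [primesProdBelow_eq_one_of_le_two (hzz.le.trans hz'2), discT_one_right]
    exact zero_le_one

/-! ### `∑_{w ≤ p < z} g(p)` under `Ω(κ, L)` -/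

/-- **`∑_{w ≤ p < z} g(p) ≤ κ log(log z/log w) + L/log w`** for `2 ≤ w ≤ z` under `Ω(κ, L)`:
`g(p) ≤ −log(1 − g(p))` and the logarithm of the dimension condition. [folklore] -/
theorem sum_primes_g_le (hdim : HasIwaniecDimension g κ L) {w z : ℝ} (hw : 2 ≤ w) (hwz : w ≤ z) :
    ∑ p ∈ (Nat.primesBelow ⌈z⌉₊).filter (fun p : ℕ => w ≤ (p : ℝ)), g p ≤
      κ * Real.log (Real.log z / Real.log w) + L / Real.log w := by
  set S := (Nat.primesBelow ⌈z⌉₊).filter (fun p : ℕ => w ≤ (p : ℝ)) with hS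
  have hL : 0 ≤ L := hdim.nonneg
  have hlogw : 0 < Real.log w := Real.log_pos (by linarith)
  have hratio : 1 ≤ Real.log z / Real.log w := by
    rw [le_div_iff₀ hlogw, one_mul]; exact Real.log_le_log (by linarith) hwz
  have hprime : ∀ p ∈ S, p.Prime := fun p hp => Nat.prime_of_mem_primesBelow (Finset.mem_filter.mp hp).1
  have hterm : ∀ p ∈ S, g p ≤ Real.log ((1 - g p)⁻¹) := by
    intro p hp
    obtain ⟨h0, h1⟩ := hdim.1 p (hprime p hp)
    rw [Real.log_inv]
    have := Real.add_one_le_exp (-(g p))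
    have h2 : 1 - g p ≤ Real.exp (-(g p)) := by linarith
    have h3 : Real.log (1 - g p) ≤ -(g p) := by
      rw [Real.log_le_iff_le_exp (by linarith)]; exact h2
    linarith
  have hpos : ∀ p ∈ S, 0 < (1 - g p)⁻¹ := fun p hp => inv_pos.mpr (sub_pos.mpr (hdim.1 p (hprime p hp)).2)
  have hprod := hdim.2 w z hw hwz
  have hprodpos : 0 < ∏ p ∈ S, (1 - g p)⁻¹ := Finset.prod_pos hpos
  calc ∑ p ∈ S, g p ≤ ∑ p ∈ S, Real.log ((1 - g p)⁻¹) := Finset.sum_le_sum hterm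
    _ = Real.log (∏ p ∈ S, (1 - g p)⁻¹) := (Real.log_prod (s := S) (fun p hp => (hpos p hp).ne')).symm
    _ ≤ Real.log ((Real.log z / Real.log w) ^ κ * (1 + L / Real.log w)) := Real.log_le_log hprodpos hprod
    _ = κ * Real.log (Real.log z / Real.log w) + Real.log (1 + L / Real.log w) := by
        rw [Real.log_mul (Real.rpow_pos_of_pos (by linarith) κ).ne' (by positivity),
          Real.log_rpow (by linarith)]
    _ ≤ κ * Real.log (Real.log z / Real.log w) + L / Real.log w := by
        have h1 : Real.log (1 + L / Real.log w) ≤ L / Real.log w := by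
          have := Real.add_one_le_exp (L / Real.log w)
          rw [Real.log_le_iff_le_exp (by positivity)]; linarith
        linarith

/-- **The primes of `[y/2, z)` carry little mass**: `∑_{y/2 ≤ p < z} g(p) ≤ (log 2 + 2L)/log y` for
`4 ≤ y/2 ≤ z ≤ y` under `Ω(κ, L)` with `κ ≤ 1/2`. [folklore] -/
theorem sum_primes_g_half_le (hdim : HasIwaniecDimension g κ L) (hκ : 0 ≤ κ) (hκ2 : κ ≤ 1 / 2) {y z : ℝ}
    (hy : 8 ≤ y) (hyz : y / 2 ≤ z) (hzy : z ≤ y) :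
    ∑ p ∈ (Nat.primesBelow ⌈z⌉₊).filter (fun p : ℕ => y / 2 ≤ (p : ℝ)), g p ≤ (Real.log 2 + 2 * L) / Real.log y := by
  have hL : 0 ≤ L := hdim.nonneg
  have hlog2 : 0 < Real.log 2 := Real.log_pos one_lt_two
  have hy0 : 0 < y := by linarith
  have hly : Real.log 8 ≤ Real.log y := Real.log_le_log (by norm_num) hy
  have hlog8 : Real.log 8 = 3 * Real.log 2 := by
    rw [show (8:ℝ) = 2 ^ 3 by norm_num, Real.log_pow]; norm_num
  have hlw : Real.log (y / 2) = Real.log y - Real.log 2 := Real.log_div hy0.ne' two_ne_zero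
  have hlwpos : 0 < Real.log y - Real.log 2 := by linarith
  have hlypos : 0 < Real.log y := by linarith
  refine (sum_primes_g_le hdim (by linarith) hyz).trans ?_
  rw [hlw]
  -- `log(log z / log(y/2)) ≤ log z/log(y/2) - 1 ≤ log 2/(log y - log 2)`
  have hz0 : 0 < z := by linarith
  have h1 : Real.log (Real.log z / (Real.log y - Real.log 2)) ≤ Real.log 2 / (Real.log y - Real.log 2) := by
    have hq : 0 < Real.log z / (Real.log y - Real.log 2) := div_pos (Real.log_pos (by linarith)) hlwpos
    have := Real.add_one_le_exp (Real.log z / (Real.log y - Real.log 2) - 1)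
    have h2 : Real.log (Real.log z / (Real.log y - Real.log 2)) ≤ Real.log z / (Real.log y - Real.log 2) - 1 := by
      rw [Real.log_le_iff_le_exp hq]; linarith
    have h3 : Real.log z / (Real.log y - Real.log 2) - 1 ≤ Real.log 2 / (Real.log y - Real.log 2) := by
      rw [div_sub_one hlwpos.ne', div_le_div_iff_of_pos_right hlwpos]
      linarith [Real.log_le_log hz0 hzy]
    linarith
  -- `1/(log y - log 2) ≤ 2/log y` since `log y ≥ 2 log 2`
  have h4 : 1 / (Real.log y - Real.log 2) ≤ 2 / Real.log y := by
    rw [div_le_div_iff₀ hlwpos hlypos]; linarith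
  have h5 : κ * Real.log (Real.log z / (Real.log y - Real.log 2)) ≤ 1 / 2 * (Real.log 2 / (Real.log y - Real.log 2)) := by
    calc κ * Real.log (Real.log z / (Real.log y - Real.log 2)) ≤ κ * (Real.log 2 / (Real.log y - Real.log 2)) :=
          mul_le_mul_of_nonneg_left h1 hκ
      _ ≤ 1 / 2 * (Real.log 2 / (Real.log y - Real.log 2)) :=
          mul_le_mul_of_nonneg_right hκ2 (div_nonneg hlog2.le hlwpos.le)
  have e1 : Real.log 2 / (Real.log y - Real.log 2) = Real.log 2 * (1 / (Real.log y - Real.log 2)) := by ring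
  have e2 : L / (Real.log y - Real.log 2) = L * (1 / (Real.log y - Real.log 2)) := by ring
  rw [e1] at h5; rw [e2]
  have h6 : Real.log 2 * (1 / (Real.log y - Real.log 2)) ≤ Real.log 2 * (2 / Real.log y) :=
    mul_le_mul_of_nonneg_left h4 hlog2.le
  have h7 : L * (1 / (Real.log y - Real.log 2)) ≤ L * (2 / Real.log y) := mul_le_mul_of_nonneg_left h4 hL
  have e3 : (Real.log 2 + 2 * L) / Real.log y = 1 / 2 * (Real.log 2 * (2 / Real.log y)) + L * (2 / Real.log y) := by
    field_simp
  rw [e3]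
  linarith

/-! ### The truncation level `z₀ = exp((log y)^{19/20})`, `s₀ = (log y)^{1/20}` -/

/-- Basic facts at a level `y` with `log y ≥ 2^{20}` and `(log y)^{19/20} ≤ log z`, `z ≥ 2`:
`1 < y`, `s₀ = (log y)^{1/20} ≥ 2`, `s₀ · (log y)^{19/20} = log y`, `2 ≤ z₀ = exp((log y)^{19/20}) ≤ z`,
`0 < s = log y/log z ≤ s₀`, `1 ≤ (log y)^{19/20}`, `log y / (log y)^{19/20} = s₀`. [folklore] -/
theorem level_facts_one {y z : ℝ} (hy : Real.exp (2 ^ 20) ≤ y) (hz : 2 ≤ z)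
    (hsz : Real.log y ^ ((19:ℝ) / 20) ≤ Real.log z) :
    1 < y ∧ (2:ℝ) ^ 20 ≤ Real.log y ∧ 2 ≤ Real.log y ^ ((1:ℝ) / 20) ∧
      Real.log y ^ ((1:ℝ) / 20) * Real.log y ^ ((19:ℝ) / 20) = Real.log y ∧
      2 ≤ Real.exp (Real.log y ^ ((19:ℝ) / 20)) ∧ Real.exp (Real.log y ^ ((19:ℝ) / 20)) ≤ z ∧
      0 < Real.log y / Real.log z ∧ Real.log y / Real.log z ≤ Real.log y ^ ((1:ℝ) / 20) ∧
      1 ≤ Real.log y ^ ((19:ℝ) / 20) ∧ Real.log y / Real.log y ^ ((19:ℝ) / 20) = Real.log y ^ ((1:ℝ) / 20) := by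
  have h220 : (1:ℝ) ≤ 2 ^ 20 := by norm_num
  have hy1 : 1 < y := lt_of_lt_of_le (by linarith [Real.add_one_le_exp ((2:ℝ) ^ 20)]) hy
  have hy0 : 0 < y := by linarith
  have hly : (2:ℝ) ^ 20 ≤ Real.log y := by rw [Real.le_log_iff_exp_le hy0]; exact hy
  have hly1 : 1 ≤ Real.log y := h220.trans hly
  have hly0 : 0 < Real.log y := by linarith
  have hs₀2 : 2 ≤ Real.log y ^ ((1:ℝ) / 20) := by
    have h : ((2:ℝ) ^ 20) ^ ((1:ℝ) / 20) = 2 := by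
      rw [show ((2:ℝ) ^ 20) = (2:ℝ) ^ ((20:ℕ):ℝ) by norm_num, ← Real.rpow_mul (by norm_num)]; norm_num
    rw [← h]
    exact Real.rpow_le_rpow (by norm_num) hly (by norm_num)
  have hmul : Real.log y ^ ((1:ℝ) / 20) * Real.log y ^ ((19:ℝ) / 20) = Real.log y := by
    rw [← Real.rpow_add hly0]; norm_num
  have h19 : 1 ≤ Real.log y ^ ((19:ℝ) / 20) := Real.one_le_rpow hly1 (by norm_num)
  have hz₀2 : 2 ≤ Real.exp (Real.log y ^ ((19:ℝ) / 20)) := by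
    have : (2:ℝ) ≤ Real.exp 1 := by linarith [Real.add_one_le_exp (1:ℝ)]
    exact this.trans (Real.exp_le_exp.mpr h19)
  have hz1 : 1 < z := by linarith
  have hlogz : 0 < Real.log z := Real.log_pos hz1
  have hz₀z : Real.exp (Real.log y ^ ((19:ℝ) / 20)) ≤ z := by
    calc Real.exp (Real.log y ^ ((19:ℝ) / 20)) ≤ Real.exp (Real.log z) := Real.exp_le_exp.mpr hsz
      _ = z := Real.exp_log (by linarith)
  have h1920 : 0 < Real.log y ^ ((19:ℝ) / 20) := by linarith
  have hdiv : Real.log y / Real.log y ^ ((19:ℝ) / 20) = Real.log y ^ ((1:ℝ) / 20) := by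
    rw [div_eq_iff h1920.ne', hmul]
  refine ⟨hy1, hly, hs₀2, hmul, hz₀2, hz₀z, div_pos hly0 hlogz, ?_, h19, hdiv⟩
  rw [div_le_iff₀ hlogz]
  calc Real.log y = Real.log y ^ ((1:ℝ) / 20) * Real.log y ^ ((19:ℝ) / 20) := hmul.symm
    _ ≤ Real.log y ^ ((1:ℝ) / 20) * Real.log z := mul_le_mul_of_nonneg_left hsz (by linarith)

/-- `V(P(z₀)) ≤ (s₀/s)^κ (1 + L/(log y)^{19/20}) V(P(z))` at the truncation level `z₀ = exp((log y)^{19/20})`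
(`Ω(κ, L)`). [folklore] -/
theorem vprod_trunc_le_one (hdim : HasIwaniecDimension g κ L) {y z : ℝ} (hy : Real.exp (2 ^ 20) ≤ y)
    (hz : 2 ≤ z) (hsz : Real.log y ^ ((19:ℝ) / 20) ≤ Real.log z) :
    vprod g (primesProdBelow (Real.exp (Real.log y ^ ((19:ℝ) / 20)))) ≤
      (Real.log y ^ ((1:ℝ) / 20) / (Real.log y / Real.log z)) ^ κ * (1 + L / Real.log y ^ ((19:ℝ) / 20)) *
        vprod g (primesProdBelow z) := by
  obtain ⟨hy1, -, hs2, hmul, hz₀2, hz₀z, hs0, -, h19, hdiv⟩ := level_facts_one hy hz hsz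
  have h := hdim.vprod_le hz₀2 hz₀z
  rw [Real.log_exp] at h
  have hlogz : 0 < Real.log z := Real.log_pos (by linarith)
  have h1920 : 0 < Real.log y ^ ((19:ℝ) / 20) := by linarith
  have hly0 : 0 < Real.log y := Real.log_pos hy1
  have hratio : Real.log z / Real.log y ^ ((19:ℝ) / 20) = Real.log y ^ ((1:ℝ) / 20) / (Real.log y / Real.log z) := by
    rw [div_div_eq_mul_div, div_eq_div_iff h1920.ne' hly0.ne', ← hdiv]
    field_simp
  rwa [hratio] at h

/-- **Stability of the region under `(y, z) ↦ (y/p, p)`**: if `exp((log y)^{19/20}) ≤ p < y` then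
`(log(y/p))^{19/20} ≤ log p`. [folklore] -/
theorem region_div_one {y p : ℝ} (hy1 : 1 < y) (hp : Real.exp (Real.log y ^ ((19:ℝ) / 20)) ≤ p) (hpy : p < y)
    (hp0 : 0 < p) : Real.log (y / p) ^ ((19:ℝ) / 20) ≤ Real.log p := by
  have hlogp : Real.log y ^ ((19:ℝ) / 20) ≤ Real.log p := by
    have := Real.log_le_log (Real.exp_pos _) hp
    rwa [Real.log_exp] at this
  have hp1 : 1 ≤ p := by
    have h2 : (1:ℝ) ≤ Real.exp (Real.log y ^ ((19:ℝ) / 20)) := by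
      have : 0 ≤ Real.log y ^ ((19:ℝ) / 20) := Real.rpow_nonneg (Real.log_pos hy1).le _
      exact Real.one_le_exp this
    exact h2.trans hp
  rw [Real.log_div (by linarith) hp0.ne']
  refine le_trans (Real.rpow_le_rpow ?_ ?_ (by norm_num)) hlogp
  · linarith [Real.log_lt_log hp0 hpy]
  · linarith [Real.log_nonneg hp1]

end BetaSieve

end Literature.NumberTheory.Sieve

namespace Literature.NumberTheory.Sieve

namespace BetaSieve

open BetaSieveForward (sieveKernel sieveKernel_nonneg continuousOn_sieveKernel)

variable {g : ArithmeticFunction ℝ} {L : ℝ}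

/-- **The crude bound at the truncation level `z₀ = exp((log y)^{19/20})`** (Iwaniec (8.4), qualitative form
for `κ = 1/2`, `β = 1`, `s₀ = (log y)^{1/20}`): there are `C` and `y_c` such that for every multiplicative `g`
with `Ω(1/2, L)`, all `y ≥ y_c`, both parities and all `N`,
`∑_{n ≤ N} T_n(y, P(z₀)) ≤ C V(P(z₀)) s₀^{−1/2} e^{−s₀} (log y)^{−3/8}` (Rankin's trick with `Λ = 9`: the terms
with `n + 1 ≤ s₀` vanish, the others total `≤ (9/8) 9^{1 − s₀} V^{−9}`, and `V^{−1} ≤ K₁ s₀^{10}`).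
[cite: IwaniecActaArith1980, §8 (8.4)] -/
theorem discT_trunc_le_one (hL : 0 ≤ L) :
    ∃ C yc : ℝ, 0 ≤ C ∧ 1 < yc ∧ ∀ g : ArithmeticFunction ℝ, g.IsMultiplicative → HasIwaniecDimension g (1 / 2) L →
      ∀ y : ℝ, yc ≤ y → ∀ (par N : ℕ),
        discT par g 1 y (primesProdBelow (Real.exp (Real.log y ^ ((19:ℝ) / 20)))) N ≤
          C * vprod g (primesProdBelow (Real.exp (Real.log y ^ ((19:ℝ) / 20)))) *
            (Real.log y ^ ((1:ℝ) / 20)) ^ (-(1 / 2 : ℝ)) * Real.exp (-(Real.log y ^ ((1:ℝ) / 20))) *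
              Real.log y ^ (-(3 / 8 : ℝ)) := by
  set K₁ : ℝ := (1 + L / Real.log 2) / Real.log 2 ^ (1 / 2 : ℝ) with hK₁
  set M : ℕ := 109 with hM
  have hlog2 : 0 < Real.log 2 := Real.log_pos one_lt_two
  have hK₁0 : 0 < K₁ := div_pos (by positivity) (Real.rpow_pos_of_pos hlog2 _)
  refine ⟨9 / 8 * 9 * K₁ ^ 10 * M.factorial, Real.exp (2 ^ 20), by positivity,
    by linarith [Real.add_one_le_exp ((2:ℝ) ^ 20), show (1:ℝ) ≤ 2 ^ 20 by norm_num], ?_⟩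
  intro g hg hdim y hy par N
  obtain ⟨hy1, hly, hs2, hmul, hz2, -, -, -, h19, hdiv⟩ := level_facts_one (z := Real.exp (Real.log y ^ ((19:ℝ) / 20)))
    hy (by
      have : (2:ℝ) ≤ Real.exp 1 := by linarith [Real.add_one_le_exp (1:ℝ)]
      refine this.trans (Real.exp_le_exp.mpr (Real.one_le_rpow ?_ (by norm_num)))
      have hy1 : 1 < y := lt_of_lt_of_le (by linarith [Real.add_one_le_exp ((2:ℝ) ^ 20), show (1:ℝ) ≤ 2 ^ 20 by norm_num]) hy
      have : (2:ℝ) ^ 20 ≤ Real.log y := by rw [Real.le_log_iff_exp_le (by linarith)]; exact hy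
      linarith) (by rw [Real.log_exp])
  set ly := Real.log y with hlydef
  have hly0 : 0 < ly := by linarith
  set s := ly ^ ((1:ℝ) / 20) with hs
  have hs0 : 0 < s := by linarith
  have hs1 : 1 ≤ s := by linarith
  set z := Real.exp (ly ^ ((19:ℝ) / 20)) with hz
  have hlogz : Real.log z = ly ^ ((19:ℝ) / 20) := by rw [hz, Real.log_exp]
  have hz1 : 1 < z := by linarith
  have hy0 : 0 < y := by linarith
  set V := vprod g (primesProdBelow z) with hV
  have hVpos : 0 < V := hdim.vprod_pos z
  have h01 : ∀ p ∈ (primesProdBelow z).primeFactors, 0 ≤ g p ∧ g p < 1 := fun p hp =>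
    hdim.1 p (Nat.prime_of_mem_primeFactors hp)
  have h01' : ∀ p ∈ (primesProdBelow z).primeFactors, 0 ≤ g p ∧ g p ≤ 1 := fun p hp =>
    ⟨(h01 p hp).1, (h01 p hp).2.le⟩
  have hPsq := squarefree_primesProdBelow z
  -- powers of `s`: `log z = s^{19}`, `ly = s^{20}`
  have hs19 : ly ^ ((19:ℝ) / 20) = s ^ (19:ℕ) := by
    rw [hs, ← Real.rpow_natCast, ← Real.rpow_mul hly0.le]; norm_num
  have hs20 : ly = s ^ (20:ℕ) := by
    rw [hs, ← Real.rpow_natCast, ← Real.rpow_mul hly0.le]; norm_num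
  -- (a) `V⁻¹ ≤ K₁ s^{10}`
  have hVinv : V⁻¹ ≤ K₁ * s ^ (10:ℕ) := by
    have h1 := hdim.inv_vprod_le hz2
    rw [hlogz, hs19] at h1
    have h3 : (s ^ (19:ℕ) / Real.log 2) ^ (1 / 2 : ℝ) = (s ^ (19:ℕ)) ^ (1 / 2 : ℝ) / Real.log 2 ^ (1 / 2 : ℝ) :=
      Real.div_rpow (pow_nonneg hs0.le _) hlog2.le _
    have h4 : (s ^ (19:ℕ)) ^ (1 / 2 : ℝ) ≤ s ^ (10:ℕ) := by
      rw [← Real.rpow_natCast s 19, ← Real.rpow_mul hs0.le, ← Real.rpow_natCast s 10]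
      exact Real.rpow_le_rpow_of_exponent_le hs1 (by norm_num)
    calc V⁻¹ ≤ (s ^ (19:ℕ) / Real.log 2) ^ (1 / 2 : ℝ) * (1 + L / Real.log 2) := h1
      _ ≤ (s ^ (10:ℕ) / Real.log 2 ^ (1 / 2 : ℝ)) * (1 + L / Real.log 2) := by
          gcongr
          exact h3.le.trans (div_le_div_of_nonneg_right h4 (Real.rpow_pos_of_pos hlog2 _).le)
      _ = K₁ * s ^ (10:ℕ) := by rw [hK₁]; ring
  -- (b) Rankin with `Λ = 9`
  set n₀ : ℕ := ⌊s - 1⌋₊ + 1 with hn₀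
  have hsdef : Real.log y / Real.log z = s := by rw [hlogz]; exact hdiv
  have hterm : ∀ n ∈ Finset.range (N + 1), bdrySum par g 1 y (primesProdBelow z) n ≤
      if n₀ ≤ n then V ^ (-(9 : ℝ)) * (1 / 9 : ℝ) ^ n else 0 := by
    intro n _
    split_ifs with hn
    · calc bdrySum par g 1 y (primesProdBelow z) n
          ≤ ∑ t ∈ (primesProdBelow z).divisors with t.primeFactors.card = n, g t :=
            bdrySum_le_sum hg hPsq h01' par 1 y n
        _ ≤ (∏ p ∈ (primesProdBelow z).primeFactors, (1 + 9 * g p)) / 9 ^ n :=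
            sum_divisors_card_eq_le hg hPsq (fun p hp => (h01 p hp).1) (by norm_num) n
        _ ≤ V ^ (-(9 : ℝ)) / 9 ^ n :=
            div_le_div_of_nonneg_right (prod_one_add_mul_le h01 (by norm_num)) (by positivity)
        _ = V ^ (-(9 : ℝ)) * (1 / 9 : ℝ) ^ n := by rw [one_div, inv_pow, div_eq_mul_inv]
    · push Not at hn
      rcases Nat.eq_zero_or_pos n with hn0 | hnpos
      · subst hn0; exact (bdrySum_zero par g 1 y (primesProdBelow_ne_zero z)).le
      · refine (bdrySum_eq_zero_of_card_add_le one_pos hz1 hy0 ?_).le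
        rw [hsdef]
        have hnle : n ≤ ⌊s - 1⌋₊ := Nat.le_of_lt_succ hn
        have hpos : 0 < ⌊s - 1⌋₊ := lt_of_lt_of_le hnpos hnle
        have hsb : 0 ≤ s - 1 := by
          have := Nat.floor_pos.mp hpos
          linarith
        have : (n : ℝ) ≤ ⌊s - 1⌋₊ := by exact_mod_cast hnle
        linarith [Nat.floor_le hsb]
  have hsum : discT par g 1 y (primesProdBelow z) N ≤
      V ^ (-(9 : ℝ)) * ((1 / 9 : ℝ) ^ n₀ / (1 - 1 / 9)) := by
    calc discT par g 1 y (primesProdBelow z) N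
        ≤ ∑ n ∈ Finset.range (N + 1), (if n₀ ≤ n then V ^ (-(9 : ℝ)) * (1 / 9 : ℝ) ^ n else 0) :=
          Finset.sum_le_sum hterm
      _ = V ^ (-(9 : ℝ)) * ∑ n ∈ Finset.Ico n₀ (N + 1), (1 / 9 : ℝ) ^ n := by
          rw [← Finset.sum_filter, Finset.mul_sum]
          refine Finset.sum_congr ?_ fun _ _ => rfl
          ext n
          simp only [Finset.mem_filter, Finset.mem_range, Finset.mem_Ico, and_comm]
      _ ≤ V ^ (-(9 : ℝ)) * ((1 / 9 : ℝ) ^ n₀ / (1 - 1 / 9)) :=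
          mul_le_mul_of_nonneg_left (geom_sum_Ico_le_of_lt_one (by norm_num) (by norm_num))
            (Real.rpow_nonneg hVpos.le _)
  -- (c) `(1/9)^{n₀} ≤ 9 e^{-2s}`
  have hgeo : (1 / 9 : ℝ) ^ n₀ ≤ (9 : ℝ) * Real.exp (-(2 * s)) := by
    have hn₀s : s - 1 < n₀ := by rw [hn₀]; push_cast; exact Nat.lt_floor_add_one (s - 1)
    have e1 : (1 / 9 : ℝ) ^ n₀ = (9 : ℝ) ^ (-(n₀ : ℝ)) := by
      rw [Real.rpow_neg (by norm_num), Real.rpow_natCast, one_div, inv_pow]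
    rw [e1]
    have hlog9 : 2 ≤ Real.log 9 := by
      rw [Real.le_log_iff_exp_le (by norm_num)]
      have := Real.exp_one_lt_d9
      have h2 : Real.exp 2 = Real.exp 1 * Real.exp 1 := by rw [← Real.exp_add]; norm_num
      nlinarith [Real.exp_pos 1]
    calc (9 : ℝ) ^ (-(n₀ : ℝ)) ≤ (9 : ℝ) ^ (1 - s) :=
          Real.rpow_le_rpow_of_exponent_le (by norm_num) (by linarith)
      _ = (9 : ℝ) ^ (1:ℝ) * (9 : ℝ) ^ (-s) := by rw [sub_eq_add_neg, Real.rpow_add (by norm_num)]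
      _ ≤ 9 * Real.exp (-(2 * s)) := by
          rw [Real.rpow_one]
          gcongr
          rw [Real.rpow_def_of_pos (by norm_num)]
          exact Real.exp_le_exp.mpr (by nlinarith)
  -- (d) powers of `s` against `e^{-s}`
  have hfac := pow_mul_exp_neg_le_factorial hs0.le M
  have hly38 : (s ^ (8:ℕ))⁻¹ ≤ ly ^ (-(3 / 8 : ℝ)) := by
    rw [hs20, ← Real.rpow_natCast s 20, ← Real.rpow_mul hs0.le,
      show ((20:ℕ):ℝ) * (-(3 / 8 : ℝ)) = -((15:ℝ) / 2) by norm_num, Real.rpow_neg hs0.le,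
      ← Real.rpow_natCast s 8]
    refine inv_anti₀ (Real.rpow_pos_of_pos hs0 _) ?_
    exact Real.rpow_le_rpow_of_exponent_le hs1 (by norm_num)
  have hsk : (s ^ (1:ℕ))⁻¹ ≤ s ^ (-(1 / 2 : ℝ)) := by
    rw [pow_one, Real.rpow_neg hs0.le]
    refine inv_anti₀ (Real.rpow_pos_of_pos hs0 _) ?_
    calc s ^ (1 / 2 : ℝ) ≤ s ^ (1:ℝ) := Real.rpow_le_rpow_of_exponent_le hs1 (by norm_num)
      _ = s := Real.rpow_one s
  have hV9 : V ^ (-(9 : ℝ)) ≤ V * (K₁ * s ^ (10:ℕ)) ^ 10 := by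
    have hVle : V⁻¹ ^ 10 ≤ (K₁ * s ^ (10:ℕ)) ^ 10 := pow_le_pow_left₀ (inv_nonneg.mpr hVpos.le) hVinv 10
    have e1 : V ^ (-(9 : ℝ)) = V * V⁻¹ ^ 10 := by
      rw [Real.rpow_neg hVpos.le, show (9:ℝ) = ((9:ℕ):ℝ) by norm_num, Real.rpow_natCast, ← inv_pow,
        pow_succ V⁻¹ 9, mul_comm V, mul_assoc, inv_mul_cancel₀ hVpos.ne', mul_one]
    rw [e1]
    exact mul_le_mul_of_nonneg_left hVle hVpos.le
  have hexp : Real.exp (-(2 * s)) = Real.exp (-s) * Real.exp (-s) := by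
    rw [← Real.exp_add]; ring_nf
  -- (e) assembly
  calc discT par g 1 y (primesProdBelow z) N
      ≤ V ^ (-(9 : ℝ)) * ((1 / 9 : ℝ) ^ n₀ / (1 - 1 / 9)) := hsum
    _ ≤ (V * (K₁ * s ^ (10:ℕ)) ^ 10) * (((9 : ℝ) * Real.exp (-(2 * s))) / (1 - 1 / 9)) := by gcongr
    _ = (9 / 8 * 9 * K₁ ^ 10 * (s ^ M * Real.exp (-s))) *
          (V * ((s ^ (1:ℕ))⁻¹ * (Real.exp (-s) * (s ^ (8:ℕ))⁻¹))) := by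
        rw [hM, hexp]
        field_simp
        ring
    _ ≤ (9 / 8 * 9 * K₁ ^ 10 * M.factorial) *
          (V * (s ^ (-(1 / 2 : ℝ)) * (Real.exp (-s) * ly ^ (-(3 / 8 : ℝ))))) := by
        gcongr
    _ = _ := by ring

end BetaSieve

end Literature.NumberTheory.Sieve

namespace Literature.NumberTheory.Sieve

namespace BetaSieve

open BetaSieveForward (sieveKernel sieveKernel_nonneg continuousOn_sieveKernel)

variable {g : ArithmeticFunction ℝ} {κ L : ℝ}

/-! ### (7.3) between two points at `β = 1` -/

/-- `T⁻_{N+2}(s) − T⁻_{N+2}(s₀) = ∫_s^{s₀} k(t) T⁺_{N+1}(t − 1) dt` for `1 ≤ s ≤ s₀` at `β = 1` (`0 ≤ κ < 1`).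
[cite: IwaniecActaArith1980, §7 (7.3)] -/
theorem contT_zero_sub_eq_integral_one (hκ : 0 ≤ κ) (hκ1 : κ < 1) (N : ℕ) {s s₀ : ℝ} (hs : 1 ≤ s)
    (hss₀ : s ≤ s₀) :
    contT 0 κ 1 (N + 2) s - contT 0 κ 1 (N + 2) s₀ =
      ∫ t in s..s₀, sieveKernel κ t * contT 1 κ 1 (N + 1) (t - 1) := by
  set U := max s₀ (1 + (N + 1 : ℕ) + 1) with hU
  have h1 := contT_zero_succ_eq_integral_one hκ hκ1 (N + 1) hs
    (show max s (1 + (N + 1 : ℕ) + 1) ≤ U from max_le (hss₀.trans (le_max_left _ _)) (le_max_right _ _))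
  have h2 := contT_zero_succ_eq_integral_one hκ hκ1 (N + 1) (hs.trans hss₀) (le_refl U)
  rw [show N + 2 = N + 1 + 1 by ring, h1, h2]
  rw [← intervalIntegral.integral_add_adjacent_intervals
    (intervalIntegrable_sieveKernel_mul_of_one_le hκ1 (continuous_contT_one hκ hκ1 1 (N + 1)) hs hss₀)
    (intervalIntegrable_sieveKernel_mul_of_one_le hκ1 (continuous_contT_one hκ hκ1 1 (N + 1)) (hs.trans hss₀)
      (le_max_left s₀ _))]
  ring

/-- `T⁺_{N+2}(s) − T⁺_{N+2}(s₀) = ∫_s^{s₀} k(t) T⁻_{N+1}(t − 1) dt` for `2 ≤ s ≤ s₀` at `β = 1` (`0 ≤ κ < 1`).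
[cite: IwaniecActaArith1980, §7 (7.3)] -/
theorem contT_one_sub_eq_integral_one (hκ : 0 ≤ κ) (hκ1 : κ < 1) (N : ℕ) {s s₀ : ℝ} (hs : 2 ≤ s)
    (hss₀ : s ≤ s₀) :
    contT 1 κ 1 (N + 2) s - contT 1 κ 1 (N + 2) s₀ =
      ∫ t in s..s₀, sieveKernel κ t * contT 0 κ 1 (N + 1) (t - 1) := by
  set U := max s₀ (1 + (N + 1 : ℕ) + 1) with hU
  have h1 := contT_one_succ_eq_integral_one hκ hκ1 (N + 1) hs
    (show max s (1 + (N + 1 : ℕ) + 1) ≤ U from max_le (hss₀.trans (le_max_left _ _)) (le_max_right _ _))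
  have h2 := contT_one_succ_eq_integral_one hκ hκ1 (N + 1) (hs.trans hss₀) (le_refl U)
  rw [show N + 2 = N + 1 + 1 by ring, h1, h2]
  have hs1 : 1 ≤ s := by linarith
  rw [← intervalIntegral.integral_add_adjacent_intervals
    (intervalIntegrable_sieveKernel_mul_of_one_le hκ1 (continuous_contT_one hκ hκ1 0 (N + 1)) hs1 hss₀)
    (intervalIntegrable_sieveKernel_mul_of_one_le hκ1 (continuous_contT_one hκ hκ1 0 (N + 1)) (hs1.trans hss₀)
      (le_max_left s₀ _))]
  ring

/-- `(a/b)^{−r} = a^{−r} b^{r}` for `a, b > 0`. [folklore] -/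
theorem div_rpow_neg_eq {a b r : ℝ} (ha : 0 < a) (hb : 0 < b) : (a / b) ^ (-r) = a ^ (-r) * b ^ r := by
  rw [Real.div_rpow ha.le hb.le, Real.rpow_neg hb.le, div_inv_eq_mul]

/-- Facts about the cap point `s₁ = log y/log(y/2) = ly/(ly − log 2)` for `ly ≥ 4`: `1 < s₁ ≤ 2`,
`1 − 1/s₁ = log 2/ly` and `s₁ − 1 ≤ 2/ly`. [folklore] -/
theorem cap_point_facts {ly : ℝ} (hly4 : 4 ≤ ly) :
    1 < ly / (ly - Real.log 2) ∧ ly / (ly - Real.log 2) ≤ 2 ∧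
      1 - 1 / (ly / (ly - Real.log 2)) = Real.log 2 / ly ∧ ly / (ly - Real.log 2) - 1 ≤ 2 / ly := by
  have hlog2 : 0 < Real.log 2 := Real.log_pos one_lt_two
  have hlog2' : Real.log 2 < 1 := by have := Real.log_two_lt_d9; linarith
  have hlypos : 0 < ly := by linarith
  have hlyl2 : 0 < ly - Real.log 2 := by linarith
  refine ⟨?_, ?_, ?_, ?_⟩
  · rw [lt_div_iff₀ hlyl2]; linarith
  · rw [div_le_iff₀ hlyl2]; linarith
  · field_simp; ring
  · rw [div_sub_one hlyl2.ne', div_le_div_iff₀ hlyl2 hlypos]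
    have : Real.log 2 * ly ≤ 1 * ly := mul_le_mul_of_nonneg_right hlog2'.le hlypos.le
    nlinarith

/-! ### The lower-parity induction step at `β = 1` -/

set_option maxHeartbeats 1600000 in
/-- **Induction step for `T⁻` at `β = 1`** (Iwaniec, §8, proof of Lemma 20, lower sign, for `κ ≤ 1/2`): if the
upper partial sums `T⁺_{N+1}` satisfy the inductive bound with amplitude `a` at every level `y' > 1` of the region
`(log y')^{19/20} ≤ log z'`, then `T⁻_{N+2}` satisfies it with amplitude `3 + (1 + ε) a` for `y ≥ y₀`, `z < y`.
The level is decomposed at `z₀ = exp((log y)^{19/20})`: `T⁻_{N+2}(y, P(z₀))` is bounded crudely (`hcrude`), the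
primes `z₀ ≤ p < z` are peeled off ((4.4)); for `p ≥ y/2` the trivial bound `T⁺(y/p, P(p)) ≤ 1` and
`∑_{y/2 ≤ p < z} g(p) ≤ (log 2 + 2L)/log y` are used (Iwaniec's condition `2p < y` in (8.8)); for `p < y/2` the
inductive bound is inserted at `(y/p, p)` and Lemma 21 (`sum_peeled_le`) is applied to the weight `Φ(max(t, s₁))`,
`s₁ = log y/log(y/2)`, whose boundary value carries the factor `(1 − 1/s₁)^{−κ} = (log y/log 2)^κ` of (8.9).
[cite: IwaniecActaArith1980, Lemma 20 (proof, (8.8)–(8.9))] -/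
theorem step_zero_one {ε₁ R c₀ : ℝ} {Hp Hm : ℝ → ℝ}
    (hκ : 0 < κ) (hκ2 : κ ≤ 1 / 2) (hL : 0 ≤ L) (hε₁ : 0 ≤ ε₁) (hR : 0 ≤ R) (hc₀ : 0 ≤ c₀)
    (hHpos : ∀ s, 0 < Hp s ∧ 0 < Hm s) (hHp_anti : Antitone Hp) (hHm_anti : Antitone Hm) (hHp_cont : Continuous Hp)
    (hH1 : ∀ s U : ℝ, 1 < s → s ≤ U →
      ∫ t in s..U, sieveKernel κ t * (1 - 1 / t) ^ (-(3 / 8 : ℝ)) * Hp (t - 1) ≤ (1 + ε₁) * Hm s)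
    (hH3 : ∀ s, 1 ≤ s → Hp (s - 1) ≤ R * Hm s)
    (hH4 : ∀ (N : ℕ) (u : ℝ), 0 ≤ u → contT 1 κ 1 N u ≤ c₀ * Hp u)
    (hH6 : ∀ s, Real.exp (-s) ≤ Hm s)
    (hg : g.IsMultiplicative) (hdim : HasIwaniecDimension g κ L)
    {Ccr yc : ℝ} (hCcr : 0 ≤ Ccr)
    (hcrude : ∀ y : ℝ, yc ≤ y → ∀ (par N : ℕ),
      discT par g 1 y (primesProdBelow (Real.exp (Real.log y ^ ((19:ℝ) / 20)))) N ≤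
        Ccr * vprod g (primesProdBelow (Real.exp (Real.log y ^ ((19:ℝ) / 20)))) *
          (Real.log y ^ ((1:ℝ) / 20)) ^ (-κ) * Real.exp (-(Real.log y ^ ((1:ℝ) / 20))) * Real.log y ^ (-(3 / 8 : ℝ)))
    {C ε y₀ : ℝ} (hC1 : 1 ≤ C) (hC2 : Ccr * (1 + L) ≤ C)
    (hC3 : (Real.log 2 + 2 * L) * (1 + L / Real.log 2) / (Real.log 2 ^ κ * Hm 2) ≤ C)
    (hC4 : ((κ + 1) * L + 1) * R * c₀ * Real.log 2 ^ (-κ) ≤ C)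
    (hy₀c : yc ≤ y₀) (hy₀ : Real.exp (2 ^ 20) ≤ y₀)
    (hε : ε₁ + ((κ + 1) * L + 1) * R * Real.log 2 ^ (-κ - 3 / 8) * Real.log y₀ ^ (κ + 3 / 8 - 19 / 20) ≤ ε)
    {a : ℝ} (ha : 0 ≤ a) {N : ℕ}
    (hP1 : ∀ y z : ℝ, 2 ≤ z → 1 < y → Real.log y ^ ((19:ℝ) / 20) ≤ Real.log z →
      discT 1 g 1 y (primesProdBelow z) (N + 1) ≤
        vprod g (primesProdBelow z) * (Real.log y / Real.log z) ^ (-κ) *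
          (contT 1 κ 1 (N + 1) (Real.log y / Real.log z) +
            a * C * Hp (Real.log y / Real.log z) * Real.log y ^ (-(3 / 8 : ℝ)))) :
    ∀ y z : ℝ, y₀ ≤ y → 2 ≤ z → z < y → Real.log y ^ ((19:ℝ) / 20) ≤ Real.log z →
      discT 0 g 1 y (primesProdBelow z) (N + 2) ≤
        vprod g (primesProdBelow z) * (Real.log y / Real.log z) ^ (-κ) *
          (contT 0 κ 1 (N + 2) (Real.log y / Real.log z) +
            (3 + (1 + ε) * a) * C * Hm (Real.log y / Real.log z) * Real.log y ^ (-(3 / 8 : ℝ))) := by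
  intro y z hy hz hzy hsz
  have hκ1 : κ < 1 := by linarith
  have hC0 : (0:ℝ) ≤ C := le_trans zero_le_one hC1
  have hyy : Real.exp (2 ^ 20) ≤ y := hy₀.trans hy
  obtain ⟨hy1, hly20, hs₀2, hmul, hz₀2, hz₀z, hs0, hss₀, h19, hdiv⟩ := level_facts_one hyy hz hsz
  set ly := Real.log y with hly
  set s₀ := ly ^ ((1:ℝ) / 20) with hs₀def
  set lz₀ := ly ^ ((19:ℝ) / 20) with hlz₀def
  set z₀ := Real.exp lz₀ with hz₀def
  set s := ly / Real.log z with hsdef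
  have h220 : (4:ℝ) ≤ 2 ^ 20 := by norm_num
  have hly4 : 4 ≤ ly := h220.trans hly20
  have hlypos : 0 < ly := by linarith
  have hly1 : 1 ≤ ly := by linarith
  have hs₀0 : 0 < s₀ := by linarith
  have hz1 : 1 < z := by linarith
  have hz0 : 0 < z := by linarith
  have hlogz : 0 < Real.log z := Real.log_pos hz1
  have hy0 : 0 < y := by linarith
  have hlog2 : 0 < Real.log 2 := Real.log_pos one_lt_two
  have hlog2' : Real.log 2 < 1 := by
    have := Real.log_two_lt_d9; linarith
  have hlogzy : Real.log z < ly := Real.log_lt_log hz0 hzy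
  have hs1 : 1 < s := by rw [hsdef, lt_div_iff₀ hlogz, one_mul]; exact hlogzy
  have hlz₀ : Real.log z₀ = lz₀ := by rw [hz₀def, Real.log_exp]
  have hlz₀1 : 1 ≤ lz₀ := h19
  set V := vprod g (primesProdBelow z) with hVdef
  have hV : 0 < V := hdim.vprod_pos z
  set T := ly ^ (-(3 / 8 : ℝ)) with hT
  have hT0 : 0 < T := Real.rpow_pos_of_pos hlypos _
  have hHm := (hHpos s).2
  have hVs : 0 ≤ V * s ^ (-κ) := mul_nonneg hV.le (Real.rpow_nonneg hs0.le _)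
  -- (1) decomposition at `z₀`
  have hident := discT_zero_succ_succ_sub hg 1 y hz₀z N
  -- (2) the truncated part
  have htrunc : discT 0 g 1 y (primesProdBelow z₀) (N + 2) ≤ Ccr * (1 + L) * (V * s ^ (-κ) * (Hm s * T)) := by
    have hcr : discT 0 g 1 y (primesProdBelow z₀) (N + 2) ≤
        Ccr * vprod g (primesProdBelow z₀) * s₀ ^ (-κ) * Real.exp (-s₀) * T := hcrude y (hy₀c.trans hy) 0 (N + 2)
    have hV₀ : vprod g (primesProdBelow z₀) ≤ (s₀ / s) ^ κ * (1 + L / lz₀) * V := vprod_trunc_le_one hdim hyy hz hsz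
    have hV₀pos : 0 < vprod g (primesProdBelow z₀) := hdim.vprod_pos z₀
    have h1 : Ccr * vprod g (primesProdBelow z₀) * s₀ ^ (-κ) * Real.exp (-s₀) * T ≤
        Ccr * ((s₀ / s) ^ κ * (1 + L / lz₀) * V) * s₀ ^ (-κ) * Real.exp (-s₀) * T :=
      mul_le_mul_of_nonneg_right (mul_le_mul_of_nonneg_right (mul_le_mul_of_nonneg_right
        (mul_le_mul_of_nonneg_left hV₀ hCcr) (Real.rpow_nonneg hs₀0.le _)) (Real.exp_pos _).le) hT0.le
    have h2 : (s₀ / s) ^ κ * (1 + L / lz₀) * V * s₀ ^ (-κ) = (1 + L / lz₀) * (V * s ^ (-κ)) := by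
      rw [← div_rpow_mul_rpow_neg hs0 hs₀0 κ]; ring
    have h3 : 1 + L / lz₀ ≤ 1 + L := by
      have : L / lz₀ ≤ L / 1 := div_le_div_of_nonneg_left hL one_pos hlz₀1
      rw [div_one] at this; linarith
    have h4 : Real.exp (-s₀) ≤ Hm s := (Real.exp_le_exp.mpr (neg_le_neg hss₀)).trans (hH6 s)
    calc discT 0 g 1 y (primesProdBelow z₀) (N + 2)
        ≤ Ccr * vprod g (primesProdBelow z₀) * s₀ ^ (-κ) * Real.exp (-s₀) * T := hcr
      _ ≤ Ccr * ((s₀ / s) ^ κ * (1 + L / lz₀) * V) * s₀ ^ (-κ) * Real.exp (-s₀) * T := h1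
      _ = Ccr * (1 + L / lz₀) * (V * s ^ (-κ)) * Real.exp (-s₀) * T := by
          rw [show Ccr * ((s₀ / s) ^ κ * (1 + L / lz₀) * V) * s₀ ^ (-κ) =
            Ccr * ((s₀ / s) ^ κ * (1 + L / lz₀) * V * s₀ ^ (-κ)) by ring, h2]; ring
      _ ≤ Ccr * (1 + L) * (V * s ^ (-κ)) * Hm s * T := by
          refine mul_le_mul_of_nonneg_right (mul_le_mul (mul_le_mul_of_nonneg_right
            (mul_le_mul_of_nonneg_left h3 hCcr) hVs) h4 (Real.exp_pos _).le ?_) hT0.le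
          exact mul_nonneg (mul_nonneg hCcr (by linarith)) hVs
      _ = Ccr * (1 + L) * (V * s ^ (-κ) * (Hm s * T)) := by ring
  -- (3) the peeled primes: good (`2p < y`) and bad (`y ≤ 2p`)
  set F := (Nat.primesBelow ⌈z⌉₊).filter (fun p : ℕ => z₀ ≤ (p : ℝ)) with hFdef
  have hFmem : ∀ p ∈ F, (p : ℝ) < z ∧ p.Prime ∧ z₀ ≤ (p : ℝ) := by
    intro p hp
    rw [hFdef, Finset.mem_filter, Nat.mem_primesBelow] at hp
    exact ⟨Nat.lt_ceil.mp hp.1.1, hp.1.2, hp.2⟩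
  have hsplit_sum : ∑ p ∈ F, g p * discT 1 g 1 (y / p) (primesProdBelow p) (N + 1) =
      ∑ p ∈ F.filter (fun p : ℕ => 2 * (p : ℝ) < y), g p * discT 1 g 1 (y / p) (primesProdBelow p) (N + 1) +
        ∑ p ∈ F.filter (fun p : ℕ => ¬ 2 * (p : ℝ) < y), g p * discT 1 g 1 (y / p) (primesProdBelow p) (N + 1) :=
    (Finset.sum_filter_add_sum_filter_not F _ _).symm
  -- (3-bad) the bad primes
  have hbad : ∑ p ∈ F.filter (fun p : ℕ => ¬ 2 * (p : ℝ) < y), g p * discT 1 g 1 (y / p) (primesProdBelow p) (N + 1) ≤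
      C * (V * s ^ (-κ) * (Hm s * T)) := by
    -- each term is at most `g p`, and the bad primes lie in `[y/2, z)`
    have hle : ∑ p ∈ F.filter (fun p : ℕ => ¬ 2 * (p : ℝ) < y), g p * discT 1 g 1 (y / p) (primesProdBelow p) (N + 1) ≤
        ∑ p ∈ (Nat.primesBelow ⌈z⌉₊).filter (fun p : ℕ => y / 2 ≤ (p : ℝ)), g p := by
      have hsub : F.filter (fun p : ℕ => ¬ 2 * (p : ℝ) < y) ⊆ (Nat.primesBelow ⌈z⌉₊).filter (fun p : ℕ => y / 2 ≤ (p : ℝ)) := by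
        intro p hp
        rw [Finset.mem_filter] at hp ⊢
        refine ⟨(Finset.mem_filter.mp hp.1).1, ?_⟩
        have := not_lt.mp hp.2
        linarith
      refine le_trans (Finset.sum_le_sum fun p hp => ?_) (Finset.sum_le_sum_of_subset_of_nonneg hsub fun p hp _ =>
        (hdim.1 p (Nat.prime_of_mem_primesBelow (Finset.mem_filter.mp hp).1)).1)
      obtain ⟨hpz, hpp, hz₀p⟩ := hFmem p (Finset.mem_filter.mp hp).1
      have hp0 : (0:ℝ) < p := by linarith
      have hge : y ≤ 2 * (p : ℝ) := not_lt.mp (Finset.mem_filter.mp hp).2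
      have hD4 : y / p ≤ 4 := by rw [div_le_iff₀ hp0]; linarith
      have h1 := discT_one_le_one_of_level_le_four hg hdim.1 (div_pos hy0 hp0) hD4 (p : ℝ) (N + 1)
      have hgp : 0 ≤ g p := (hdim.1 p hpp).1
      calc g p * discT 1 g 1 (y / p) (primesProdBelow p) (N + 1) ≤ g p * 1 := mul_le_mul_of_nonneg_left h1 hgp
        _ = g p := mul_one _
    refine hle.trans ?_
    by_cases hzy2 : y / 2 ≤ z
    · -- `z ≥ y/2`: then `s ≤ 2` and the mass bound applies
      have hy8 : 8 ≤ y := by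
        have : (8:ℝ) ≤ Real.exp (2 ^ 20) := by
          have h := Real.add_one_le_exp ((2:ℝ) ^ 20)
          have h8 : (8:ℝ) ≤ 2 ^ 20 + 1 := by norm_num
          linarith
        exact this.trans hyy
      have hmass := sum_primes_g_half_le hdim hκ.le hκ2 hy8 hzy2 hzy.le
      rw [← hly] at hmass
      refine hmass.trans ?_
      -- `s ≤ 2`
      have hs2 : s ≤ 2 := by
        rw [hsdef, div_le_iff₀ hlogz]
        have hlyz : Real.log (y / 2) ≤ Real.log z := Real.log_le_log (by linarith) hzy2
        rw [Real.log_div hy0.ne' two_ne_zero, ← hly] at hlyz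
        linarith
      have hHm2 : Hm 2 ≤ Hm s := hHm_anti hs2
      have hHm20 := (hHpos 2).2
      -- `V s^{-κ} ≥ log2^κ/(1 + L/log 2) · ly^{-κ}`
      have hVinv := hdim.inv_vprod_le hz
      rw [← hVdef] at hVinv
      have hA0 : 0 < 1 + L / Real.log 2 := by positivity
      have hlzκ : 0 < Real.log z ^ κ := Real.rpow_pos_of_pos hlogz κ
      have hl2κ : 0 < Real.log 2 ^ κ := Real.rpow_pos_of_pos hlog2 κ
      have hVlow : Real.log 2 ^ κ / (1 + L / Real.log 2) ≤ V * Real.log z ^ κ := by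
        have h1 : 1 ≤ V * ((Real.log z / Real.log 2) ^ κ * (1 + L / Real.log 2)) := by
          calc (1:ℝ) = V * V⁻¹ := (mul_inv_cancel₀ hV.ne').symm
            _ ≤ V * ((Real.log z / Real.log 2) ^ κ * (1 + L / Real.log 2)) := mul_le_mul_of_nonneg_left hVinv hV.le
        rw [Real.div_rpow hlogz.le hlog2.le] at h1
        have h2 : Real.log 2 ^ κ ≤ V * Real.log z ^ κ * (1 + L / Real.log 2) := by
          have := mul_le_mul_of_nonneg_right h1 hl2κ.le
          rw [one_mul] at this
          calc Real.log 2 ^ κ ≤ V * (Real.log z ^ κ / Real.log 2 ^ κ * (1 + L / Real.log 2)) * Real.log 2 ^ κ := this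
            _ = V * Real.log z ^ κ * (1 + L / Real.log 2) := by field_simp
        rw [div_le_iff₀ hA0]
        exact h2
      have hsκ : s ^ (-κ) = Real.log z ^ κ * ly ^ (-κ) := by
        rw [hsdef, div_rpow_neg_eq hlypos hlogz]; ring
      -- the key numerical inequality `(log 2 + 2L)/ly ≤ C · (log2^κ/(1+L/log2) · ly^{-κ}) · Hm 2 · T`
      have hexp : ly ^ (κ + 3 / 8 - 1) ≤ 1 := Real.rpow_le_one_of_one_le_of_nonpos hly1 (by linarith)
      have hpow : 1 / ly = ly ^ (κ + 3 / 8 - 1) * (ly ^ (-κ) * T) := by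
        rw [hT, ← Real.rpow_add hlypos, ← Real.rpow_add hlypos, one_div, ← Real.rpow_neg_one]; ring_nf
      have hnum0 : 0 ≤ Real.log 2 + 2 * L := by linarith
      have hkey : (Real.log 2 + 2 * L) / ly ≤ C * ((Real.log 2 ^ κ / (1 + L / Real.log 2)) * ly ^ (-κ)) * Hm 2 * T := by
        rw [div_eq_mul_one_div, hpow]
        have hC3' : (Real.log 2 + 2 * L) ≤ C * (Real.log 2 ^ κ * Hm 2) / (1 + L / Real.log 2) := by
          rw [le_div_iff₀ hA0]
          rw [div_le_iff₀ (mul_pos hl2κ hHm20)] at hC3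
          linarith
        have hpos2 : 0 ≤ ly ^ (-κ) * T := mul_nonneg (Real.rpow_nonneg hlypos.le _) hT0.le
        calc (Real.log 2 + 2 * L) * (ly ^ (κ + 3 / 8 - 1) * (ly ^ (-κ) * T))
            ≤ (C * (Real.log 2 ^ κ * Hm 2) / (1 + L / Real.log 2)) * (1 * (ly ^ (-κ) * T)) :=
              mul_le_mul hC3' (mul_le_mul_of_nonneg_right hexp hpos2) (by positivity)
                (div_nonneg (by positivity) hA0.le)
          _ = C * ((Real.log 2 ^ κ / (1 + L / Real.log 2)) * ly ^ (-κ)) * Hm 2 * T := by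
              field_simp
      calc (Real.log 2 + 2 * L) / ly ≤ C * ((Real.log 2 ^ κ / (1 + L / Real.log 2)) * ly ^ (-κ)) * Hm 2 * T := hkey
        _ ≤ C * (V * Real.log z ^ κ * ly ^ (-κ)) * Hm s * T := by
            refine mul_le_mul_of_nonneg_right (mul_le_mul (mul_le_mul_of_nonneg_left
              (mul_le_mul_of_nonneg_right hVlow (Real.rpow_nonneg hlypos.le _)) hC0) hHm2 hHm20.le ?_) hT0.le
            exact mul_nonneg hC0 (mul_nonneg (mul_nonneg hV.le hlzκ.le) (Real.rpow_nonneg hlypos.le _))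
        _ = C * (V * s ^ (-κ) * (Hm s * T)) := by rw [hsκ]; ring
    · -- `z < y/2`: no bad primes
      have hempty : (Nat.primesBelow ⌈z⌉₊).filter (fun p : ℕ => y / 2 ≤ (p : ℝ)) = ∅ := by
        refine Finset.filter_false_of_mem fun p hp => ?_
        have hpz : (p : ℝ) < z := Nat.lt_ceil.mp (Nat.lt_of_mem_primesBelow hp)
        push Not at hzy2 ⊢
        linarith
      rw [hempty, Finset.sum_empty]
      exact mul_nonneg hC0 (mul_nonneg hVs (mul_nonneg hHm.le hT0.le))
  -- (3-good) the weight function and the cap at `s₁ = ly / log(y/2)`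
  set s₁ := ly / (ly - Real.log 2) with hs₁def
  obtain ⟨hs₁1, hs₁2, hinv₁, hs₁sub⟩ := cap_point_facts hly4
  rw [← hs₁def] at hs₁1 hs₁2 hinv₁ hs₁sub
  have hs₁s₀ : s₁ ≤ s₀ := hs₁2.trans hs₀2
  set s₂ := max s s₁ with hs₂def
  have hs₂1 : 1 < s₂ := lt_of_lt_of_le hs1 (le_max_left _ _)
  have hss₂ : s ≤ s₂ := le_max_left _ _
  have hs₁s₂ : s₁ ≤ s₂ := le_max_right _ _
  have hs₂s₀ : s₂ ≤ s₀ := max_le hss₀ hs₁s₀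
  set Φ : ℝ → ℝ := fun t => (1 - 1 / t) ^ (-κ) * contT 1 κ 1 (N + 1) (t - 1) +
    a * C * T * ((1 - 1 / t) ^ (-κ - 3 / 8) * Hp (t - 1)) with hΦdef
  set Ψ : ℝ → ℝ := fun t => Φ (max t s₁) with hΨdef
  have haCT : 0 ≤ a * C * T := mul_nonneg (mul_nonneg ha hC0) hT0.le
  have hΦ0 : ∀ t, 1 < t → 0 ≤ Φ t := by
    intro t ht
    have h1 : 0 ≤ (1 - 1 / t) ^ (-κ) := Real.rpow_nonneg (one_sub_inv_pos ht).le _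
    have h2 : 0 ≤ (1 - 1 / t) ^ (-κ - 3 / 8) := Real.rpow_nonneg (one_sub_inv_pos ht).le _
    have h3 : 0 ≤ contT 1 κ 1 (N + 1) (t - 1) := contT_nonneg hκ.le le_rfl 1 (N + 1) (by linarith)
    have h4 := (hHpos (t - 1)).1.le
    simp only [hΦdef]
    exact add_nonneg (mul_nonneg h1 h3) (mul_nonneg haCT (mul_nonneg h2 h4))
  have hΦm : ∀ {t t' : ℝ}, 1 < t → t ≤ t' → Φ t' ≤ Φ t := by
    intro t t' ht1 htt'
    have ht'1 : 1 < t' := by linarith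
    simp only [hΦdef]
    refine add_le_add ?_ (mul_le_mul_of_nonneg_left ?_ haCT)
    · refine mul_le_mul (one_sub_inv_rpow_antitone (by linarith) ht1 htt')
        (contT_antitoneOn_one hκ.le hκ1 1 (N + 1) (show (0:ℝ) ≤ t - 1 by linarith)
          (show (0:ℝ) ≤ t' - 1 by linarith) (by linarith))
        (contT_nonneg hκ.le le_rfl 1 (N + 1) (by linarith)) (Real.rpow_nonneg (one_sub_inv_pos ht1).le _)
    · refine mul_le_mul (one_sub_inv_rpow_antitone (by linarith) ht1 htt') (hHp_anti (by linarith))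
        (hHpos _).1.le (Real.rpow_nonneg (one_sub_inv_pos ht1).le _)
  have hΦc : ContinuousOn Φ (Ioi 1) := by
    have hbase : ∀ r : ℝ, ContinuousOn (fun t : ℝ => (1 - 1 / t) ^ r) (Ioi 1) := by
      intro r t ht
      have ht1 : (1:ℝ) < t := ht
      exact ((continuousAt_const.sub (continuousAt_const.div continuousAt_id (ne_of_gt (show (0:ℝ) < id t by
        simp only [id]; linarith)))).rpow_const (Or.inl (one_sub_inv_pos ht1).ne')).continuousWithinAt
    simp only [hΦdef]
    exact ((hbase (-κ)).mul ((continuous_contT_one hκ.le hκ1 1 (N + 1)).comp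
      (continuous_id.sub continuous_const)).continuousOn).add
      (continuousOn_const.mul ((hbase (-κ - 3 / 8)).mul
        (hHp_cont.comp (continuous_id.sub continuous_const)).continuousOn))
  have hΨ0 : ∀ t, 0 ≤ Ψ t := fun t => hΦ0 _ (lt_of_lt_of_le hs₁1 (le_max_right _ _))
  have hΨm : AntitoneOn Ψ (Icc s s₀) := fun t _ t' _ htt' =>
    hΦm (lt_of_lt_of_le hs₁1 (le_max_right _ _)) (max_le_max htt' le_rfl)
  have hΨc : ContinuousOn Ψ (Icc s s₀) := by
    refine (hΦc.comp (continuous_id.max continuous_const).continuousOn fun t _ => ?_)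
    exact lt_of_lt_of_le hs₁1 (le_max_right _ _)
  have hΨs : Ψ s = Φ s₂ := rfl
  have hΨ_of_ge : ∀ t, s₁ ≤ t → Ψ t = Φ t := fun t ht => by simp only [hΨdef]; rw [max_eq_left ht]
  -- (3a) pointwise insertion of the inductive bound at the good primes
  have hpt : ∀ p ∈ F.filter (fun p : ℕ => 2 * (p : ℝ) < y),
      g p * discT 1 g 1 (y / p) (primesProdBelow p) (N + 1) ≤
        s ^ (-κ) * (g p * vprod g (primesProdBelow p) * ((Real.log p / Real.log z) ^ κ * Ψ (ly / Real.log p))) := by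
    intro p hp
    rw [Finset.mem_filter] at hp
    obtain ⟨hpz, hpp, hz₀p⟩ := hFmem p hp.1
    have hp2y : 2 * (p : ℝ) < y := hp.2
    have hp2 : (2 : ℝ) ≤ p := hz₀2.trans hz₀p
    have hp1 : (1 : ℝ) < p := by linarith
    have hp0 : (0 : ℝ) < p := by linarith
    have hpy : (p : ℝ) < y := hpz.trans hzy
    have hlogp : 0 < Real.log p := Real.log_pos hp1
    have hlogpz : Real.log p < Real.log z := Real.log_lt_log hp0 hpz
    have hlogps₀ : lz₀ ≤ Real.log p := by
      have := Real.log_le_log (by linarith : (0:ℝ) < z₀) hz₀p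
      rwa [hlz₀] at this
    set tp := ly / Real.log p with htp
    have htp_gt : s < tp := div_lt_div_of_pos_left hlypos hlogp hlogpz
    have htp_le : tp ≤ s₀ := by
      rw [htp, div_le_iff₀ hlogp, ← hdiv, div_mul_eq_mul_div, le_div_iff₀ (by linarith : (0:ℝ) < lz₀)]
      exact mul_le_mul_of_nonneg_left hlogps₀ hlypos.le
    have htp1 : 1 < tp := by linarith
    have htp0 : 0 < tp := by linarith
    -- `tp ≥ s₁` (the prime is good)
    have hlogp2 : Real.log p ≤ ly - Real.log 2 := by
      have : Real.log (2 * p) < ly := Real.log_lt_log (by linarith) hp2y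
      rw [Real.log_mul two_ne_zero hp0.ne'] at this
      linarith
    have htp_s₁ : s₁ ≤ tp := by
      rw [hs₁def, htp]
      exact div_le_div_of_nonneg_left hlypos.le hlogp hlogp2
    -- the inductive bound at `(y/p, p)`
    have hcond2 : 1 < y / p := by rw [lt_div_iff₀ hp0]; linarith
    have hcond3 : Real.log (y / p) ^ ((19:ℝ) / 20) ≤ Real.log p := region_div_one hy1 hz₀p hpy hp0
    have hind := hP1 (y / p) p hp2 hcond2 hcond3
    have hlogyp : Real.log (y / p) = ly - Real.log p := Real.log_div hy0.ne' hp0.ne'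
    rw [hlogyp] at hind
    have hlyp : ly - Real.log p = ly * (1 - 1 / tp) := by rw [htp]; field_simp
    have hs' : (ly - Real.log p) / Real.log p = tp - 1 := by rw [htp]; field_simp
    rw [hs'] at hind
    have hnorm := rpow_neg_log_div_log_sub_one hy1 hz1 hp1 hpy κ
    rw [← htp, ← hsdef] at hnorm
    have hbase0 : 0 ≤ 1 - 1 / tp := (one_sub_inv_pos htp1).le
    have hloge : (ly - Real.log p) ^ (-(3 / 8 : ℝ)) = T * (1 - 1 / tp) ^ (-(3 / 8 : ℝ)) := by
      rw [hlyp, Real.mul_rpow hlypos.le hbase0]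
    rw [hnorm, hloge] at hind
    have hgp : 0 ≤ g p := (hdim.1 p hpp).1
    have hΨtp : Ψ tp = Φ tp := hΨ_of_ge tp htp_s₁
    have hkey : vprod g (primesProdBelow p) * ((Real.log p / Real.log z) ^ κ * s ^ (-κ) * (1 - 1 / tp) ^ (-κ)) *
        (contT 1 κ 1 (N + 1) (tp - 1) + a * C * Hp (tp - 1) * (T * (1 - 1 / tp) ^ (-(3 / 8 : ℝ)))) =
        s ^ (-κ) * (vprod g (primesProdBelow p) * ((Real.log p / Real.log z) ^ κ * Ψ tp)) := by
      rw [hΨtp]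
      simp only [hΦdef]
      rw [show (-κ - 3 / 8 : ℝ) = -κ + -(3 / 8 : ℝ) by ring, Real.rpow_add (one_sub_inv_pos htp1)]
      ring
    calc g p * discT 1 g 1 (y / p) (primesProdBelow p) (N + 1)
        ≤ g p * (vprod g (primesProdBelow p) * ((Real.log p / Real.log z) ^ κ * s ^ (-κ) * (1 - 1 / tp) ^ (-κ)) *
            (contT 1 κ 1 (N + 1) (tp - 1) + a * C * Hp (tp - 1) * (T * (1 - 1 / tp) ^ (-(3 / 8 : ℝ))))) :=
          mul_le_mul_of_nonneg_left hind hgp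
      _ = s ^ (-κ) * (g p * vprod g (primesProdBelow p) * ((Real.log p / Real.log z) ^ κ * Ψ tp)) := by
          rw [hkey]; ring
  -- (3b) partial summation over all peeled primes with the capped weight
  have hgood : ∑ p ∈ F.filter (fun p : ℕ => 2 * (p : ℝ) < y), g p * discT 1 g 1 (y / p) (primesProdBelow p) (N + 1) ≤
      s ^ (-κ) * (V * (κ * (∫ t in s..s₀, Ψ t / t) + Ψ s * ((κ + 1) * L / lz₀))) := by
    have h21 := sum_peeled_le hdim hκ.le hy1 hz₀2 hz₀z (Φ := Ψ) (fun t _ => hΨ0 t)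
      (by rw [← hly, ← hsdef, hlz₀, hdiv]; exact hΨm)
      (by rw [← hly, ← hsdef, hlz₀, hdiv]; exact hΨc)
    rw [← hly, ← hsdef, hlz₀, hdiv, ← hVdef, ← hFdef] at h21
    have hterm0 : ∀ p ∈ F, 0 ≤ s ^ (-κ) * (g p * vprod g (primesProdBelow p) *
        ((Real.log p / Real.log z) ^ κ * Ψ (ly / Real.log p))) := by
      intro p hp
      obtain ⟨hpz, hpp, hz₀p⟩ := hFmem p hp
      have hp0 : (0:ℝ) < p := by linarith
      have := (hdim.1 p hpp).1
      have := (hdim.vprod_pos (p:ℝ)).le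
      have : 0 ≤ (Real.log p / Real.log z) ^ κ := Real.rpow_nonneg (div_nonneg (Real.log_nonneg (by linarith)) hlogz.le) _
      have := hΨ0 (ly / Real.log p)
      have := Real.rpow_nonneg hs0.le (-κ)
      positivity
    calc ∑ p ∈ F.filter (fun p : ℕ => 2 * (p : ℝ) < y), g p * discT 1 g 1 (y / p) (primesProdBelow p) (N + 1)
        ≤ ∑ p ∈ F.filter (fun p : ℕ => 2 * (p : ℝ) < y),
            s ^ (-κ) * (g p * vprod g (primesProdBelow p) * ((Real.log p / Real.log z) ^ κ * Ψ (ly / Real.log p))) :=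
          Finset.sum_le_sum hpt
      _ ≤ ∑ p ∈ F, s ^ (-κ) * (g p * vprod g (primesProdBelow p) * ((Real.log p / Real.log z) ^ κ * Ψ (ly / Real.log p))) :=
          Finset.sum_le_sum_of_subset_of_nonneg (Finset.filter_subset _ _) fun p hp _ => hterm0 p hp
      _ = s ^ (-κ) * ∑ p ∈ F, g p * vprod g (primesProdBelow p) * ((Real.log p / Real.log z) ^ κ * Ψ (ly / Real.log p)) := by
          rw [Finset.mul_sum]
      _ ≤ s ^ (-κ) * (V * (κ * (∫ t in s..s₀, Ψ t / t) + Ψ s * ((κ + 1) * L / lz₀))) :=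
          mul_le_mul_of_nonneg_left h21 (Real.rpow_nonneg hs0.le _)
  -- (4) the integral: the cap piece `[s, s₂]` and the main piece `[s₂, s₀]`
  have hΨint : ∀ a b : ℝ, s ≤ a → a ≤ b → b ≤ s₀ → IntervalIntegrable (fun t => Ψ t / t) volume a b := by
    intro a b ha hab hb
    refine ContinuousOn.intervalIntegrable ?_
    rw [uIcc_of_le hab]
    refine (hΨc.mono (Icc_subset_Icc ha hb)).div continuousOn_id fun t ht => ?_
    exact ne_of_gt (show (0:ℝ) < id t by simp only [id]; linarith [ht.1])
  have hcap : ∫ t in s..s₂, Ψ t / t ≤ (2 / ly) * Φ s₂ := by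
    have hmono : ∫ t in s..s₂, Ψ t / t ≤ ∫ _ in s..s₂, Φ s₂ := by
      refine intervalIntegral.integral_mono_on hss₂ (hΨint s s₂ le_rfl hss₂ hs₂s₀) intervalIntegrable_const
        fun t ht => ?_
      have ht1 : 1 < t := by linarith [ht.1]
      have hΨt : Ψ t ≤ Ψ s := hΨm ⟨le_rfl, hss₀⟩ ⟨ht.1, ht.2.trans hs₂s₀⟩ ht.1
      rw [hΨs] at hΨt
      have hΦs₂ := hΦ0 s₂ hs₂1
      calc Ψ t / t ≤ Ψ t / 1 := div_le_div_of_nonneg_left (hΨ0 t) one_pos ht1.le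
        _ ≤ Φ s₂ := by rw [div_one]; exact hΨt
    rw [intervalIntegral.integral_const, smul_eq_mul] at hmono
    have hlen : s₂ - s ≤ 2 / ly := by
      have : s₂ - s ≤ s₁ - 1 := by
        rcases le_total s s₁ with h | h
        · rw [hs₂def, max_eq_right h]; linarith
        · rw [hs₂def, max_eq_left h]; linarith
      linarith
    exact hmono.trans (mul_le_mul_of_nonneg_right hlen (hΦ0 s₂ hs₂1))
  have hmainI : κ * (∫ t in s₂..s₀, Ψ t / t) =
      (∫ t in s₂..s₀, sieveKernel κ t * contT 1 κ 1 (N + 1) (t - 1)) +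
        a * C * T * ∫ t in s₂..s₀, sieveKernel κ t * (1 - 1 / t) ^ (-(3 / 8 : ℝ)) * Hp (t - 1) := by
    have hi1 : IntervalIntegrable (fun t => sieveKernel κ t * contT 1 κ 1 (N + 1) (t - 1)) volume s₂ s₀ :=
      intervalIntegrable_sieveKernel_mul_of_one_le hκ1 (continuous_contT_one hκ.le hκ1 1 (N + 1)) hs₂1.le hs₂s₀
    have hi2 : IntervalIntegrable (fun t => sieveKernel κ t * (1 - 1 / t) ^ (-(3 / 8 : ℝ)) * Hp (t - 1)) volume s₂ s₀ := by
      refine ContinuousOn.intervalIntegrable ?_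
      rw [uIcc_of_le hs₂s₀]
      exact ((continuousOn_sieveKernel_mul_rpow κ (3 / 8)).mono fun t ht => show (1:ℝ) < t by linarith [ht.1]).mul
        (hHp_cont.comp (continuous_id.sub continuous_const)).continuousOn
    rw [← intervalIntegral.integral_const_mul, ← intervalIntegral.integral_const_mul,
      ← intervalIntegral.integral_add hi1 (hi2.const_mul _)]
    refine intervalIntegral.integral_congr fun t ht => ?_
    rw [uIcc_of_le hs₂s₀] at ht
    have ht1 : 1 < t := by linarith [ht.1]
    have ht0 : (0:ℝ) < t := by linarith
    have hΨt : Ψ t = Φ t := hΨ_of_ge t (hs₁s₂.trans ht.1)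
    simp only [hΨt, hΦdef]
    rw [sieveKernel_mul_rpow_eq ht1, sieveKernel_eq_of_one_lt ht1]
    field_simp
  have hmain : ∫ t in s₂..s₀, sieveKernel κ t * contT 1 κ 1 (N + 1) (t - 1) ≤ contT 0 κ 1 (N + 2) s := by
    rw [← contT_zero_sub_eq_integral_one hκ.le hκ1 N hs₂1.le hs₂s₀]
    have h0 := contT_nonneg hκ.le le_rfl 0 (N + 2) (show (0:ℝ) ≤ s₀ by linarith)
    have hm : contT 0 κ 1 (N + 2) s₂ ≤ contT 0 κ 1 (N + 2) s :=
      contT_antitoneOn_one hκ.le hκ1 0 (N + 2) (show (0:ℝ) ≤ s by linarith) (show (0:ℝ) ≤ s₂ by linarith) hss₂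
    linarith
  have hHpart : ∫ t in s₂..s₀, sieveKernel κ t * (1 - 1 / t) ^ (-(3 / 8 : ℝ)) * Hp (t - 1) ≤ (1 + ε₁) * Hm s :=
    (hH1 s₂ s₀ hs₂1 hs₂s₀).trans (mul_le_mul_of_nonneg_left (hHm_anti hss₂) (by linarith))
  -- (5) the boundary value `Φ(s₂)` and the cap `(1 - 1/s₂)^{-r} ≤ (log 2/ly)^{-r}`
  have hcapr : ∀ r : ℝ, 0 ≤ r → (1 - 1 / s₂) ^ (-r) ≤ (Real.log 2 / ly) ^ (-r) := by
    intro r hr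
    have h1 : Real.log 2 / ly ≤ 1 - 1 / s₂ := by
      rw [← hinv₁]
      have : 1 / s₂ ≤ 1 / s₁ := one_div_le_one_div_of_le (by linarith) hs₁s₂
      linarith
    exact Real.rpow_le_rpow_of_nonpos (div_pos hlog2 hlypos) h1 (by linarith)
  have hbdry : Φ s₂ ≤ (Real.log 2 / ly) ^ (-κ) * c₀ * (R * Hm s) +
      a * C * T * ((Real.log 2 / ly) ^ (-κ - 3 / 8) * (R * Hm s)) := by
    have h1 := hcapr κ hκ.le
    have h2 : (1 - 1 / s₂) ^ (-κ - 3 / 8) ≤ (Real.log 2 / ly) ^ (-κ - 3 / 8) := by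
      have := hcapr (κ + 3 / 8) (by linarith)
      rwa [show (-(κ + 3 / 8) : ℝ) = -κ - 3 / 8 by ring] at this
    have h3 : contT 1 κ 1 (N + 1) (s₂ - 1) ≤ c₀ * Hp (s₂ - 1) := hH4 (N + 1) (s₂ - 1) (by linarith)
    have h4 : Hp (s₂ - 1) ≤ R * Hm s := (hHp_anti (by linarith : s - 1 ≤ s₂ - 1)).trans (hH3 s hs1.le)
    have hT1 : 0 ≤ contT 1 κ 1 (N + 1) (s₂ - 1) := contT_nonneg hκ.le le_rfl 1 (N + 1) (by linarith)
    have hHp0 := (hHpos (s₂ - 1)).1.le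
    have hcap0 : 0 ≤ (Real.log 2 / ly) ^ (-κ) := Real.rpow_nonneg (div_pos hlog2 hlypos).le _
    have hcap0' : 0 ≤ (Real.log 2 / ly) ^ (-κ - 3 / 8) := Real.rpow_nonneg (div_pos hlog2 hlypos).le _
    simp only [hΦdef]
    calc (1 - 1 / s₂) ^ (-κ) * contT 1 κ 1 (N + 1) (s₂ - 1) + a * C * T * ((1 - 1 / s₂) ^ (-κ - 3 / 8) * Hp (s₂ - 1))
        ≤ (Real.log 2 / ly) ^ (-κ) * (c₀ * Hp (s₂ - 1)) + a * C * T * ((Real.log 2 / ly) ^ (-κ - 3 / 8) * Hp (s₂ - 1)) :=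
          add_le_add (mul_le_mul h1 h3 hT1 hcap0)
            (mul_le_mul_of_nonneg_left (mul_le_mul_of_nonneg_right h2 hHp0) haCT)
      _ ≤ (Real.log 2 / ly) ^ (-κ) * (c₀ * (R * Hm s)) + a * C * T * ((Real.log 2 / ly) ^ (-κ - 3 / 8) * (R * Hm s)) :=
          add_le_add (mul_le_mul_of_nonneg_left (mul_le_mul_of_nonneg_left h4 hc₀) hcap0)
            (mul_le_mul_of_nonneg_left (mul_le_mul_of_nonneg_left h4 hcap0') haCT)
      _ = _ := by ring
  -- (5') the two boundary-type coefficients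
  set cL := (κ + 1) * L + 1 with hcL
  have hcL0 : 0 ≤ cL := by rw [hcL]; positivity
  have hly₀le : Real.log y₀ ≤ ly := Real.log_le_log (by linarith [Real.exp_pos ((2:ℝ) ^ 20)]) hy
  have hly₀pos : 0 < Real.log y₀ := by
    have : (2:ℝ) ^ 20 ≤ Real.log y₀ := by
      rw [Real.le_log_iff_exp_le (by linarith [Real.exp_pos ((2:ℝ) ^ 20)])]; exact hy₀
    linarith
  have hexpA : ly ^ (κ + 3 / 8 - 19 / 20) ≤ 1 := Real.rpow_le_one_of_one_le_of_nonpos hly1 (by linarith)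
  have hexpB : ly ^ (κ + 3 / 8 - 19 / 20) ≤ Real.log y₀ ^ (κ + 3 / 8 - 19 / 20) :=
    Real.rpow_le_rpow_of_nonpos hly₀pos hly₀le (by linarith)
  have hl2κ : (Real.log 2 / ly) ^ (-κ) = Real.log 2 ^ (-κ) * ly ^ κ := div_rpow_neg_eq hlog2 hlypos
  have hl2κ' : (Real.log 2 / ly) ^ (-κ - 3 / 8) = Real.log 2 ^ (-κ - 3 / 8) * ly ^ (κ + 3 / 8) := by
    have := div_rpow_neg_eq (r := κ + 3 / 8) hlog2 hlypos
    rwa [show (-(κ + 3 / 8) : ℝ) = -κ - 3 / 8 by ring] at this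
  have h1920 : ly ^ (-((19:ℝ) / 20)) = 1 / lz₀ := by rw [hlz₀def, Real.rpow_neg hlypos.le, one_div]
  have hpowA : ly ^ κ * ly ^ (-((19:ℝ) / 20)) = ly ^ (κ + 3 / 8 - 19 / 20) * T := by
    rw [hT, ← Real.rpow_add hlypos, ← Real.rpow_add hlypos]; ring_nf
  have hpowB : ly ^ (κ + 3 / 8) * ly ^ (-((19:ℝ) / 20)) = ly ^ (κ + 3 / 8 - 19 / 20) := by
    rw [← Real.rpow_add hlypos]; ring_nf
  -- coefficient of the `c₀`-part: `cL R c₀ (log 2)^{-κ} ly^{κ - 19/20} ≤ C T`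
  have hcoefA : cL * ((Real.log 2 / ly) ^ (-κ) * c₀ * R) * (1 / lz₀) ≤ C * T := by
    rw [hl2κ, ← h1920]
    have hl20 : 0 ≤ Real.log 2 ^ (-κ) := Real.rpow_nonneg hlog2.le _
    calc cL * (Real.log 2 ^ (-κ) * ly ^ κ * c₀ * R) * ly ^ (-((19:ℝ) / 20))
        = (cL * R * c₀ * Real.log 2 ^ (-κ)) * (ly ^ κ * ly ^ (-((19:ℝ) / 20))) := by ring
      _ = (cL * R * c₀ * Real.log 2 ^ (-κ)) * ly ^ (κ + 3 / 8 - 19 / 20) * T := by rw [hpowA]; ring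
      _ ≤ C * 1 * T := by
          refine mul_le_mul_of_nonneg_right ?_ hT0.le
          refine mul_le_mul (by rw [hcL]; exact hC4) hexpA (Real.rpow_nonneg hlypos.le _) hC0
      _ = C * T := by ring
  -- coefficient of the `a`-part: `cL R (log 2)^{-κ-3/8} ly^{κ-19/20} ≤ ε - ε₁`
  have hcoefB : cL * ((Real.log 2 / ly) ^ (-κ - 3 / 8) * R) * (1 / lz₀) * T ≤ (ε - ε₁) * T := by
    rw [hl2κ', ← h1920]
    have hl20 : 0 ≤ Real.log 2 ^ (-κ - 3 / 8) := Real.rpow_nonneg hlog2.le _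
    have hK0 : 0 ≤ cL * R * Real.log 2 ^ (-κ - 3 / 8) := mul_nonneg (mul_nonneg hcL0 hR) hl20
    calc cL * (Real.log 2 ^ (-κ - 3 / 8) * ly ^ (κ + 3 / 8) * R) * ly ^ (-((19:ℝ) / 20)) * T
        = (cL * R * Real.log 2 ^ (-κ - 3 / 8)) * (ly ^ (κ + 3 / 8) * ly ^ (-((19:ℝ) / 20))) * T := by ring
      _ = (cL * R * Real.log 2 ^ (-κ - 3 / 8)) * ly ^ (κ + 3 / 8 - 19 / 20) * T := by rw [hpowB]
      _ ≤ (cL * R * Real.log 2 ^ (-κ - 3 / 8)) * Real.log y₀ ^ (κ + 3 / 8 - 19 / 20) * T :=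
          mul_le_mul_of_nonneg_right (mul_le_mul_of_nonneg_left hexpB hK0) hT0.le
      _ ≤ (ε - ε₁) * T := mul_le_mul_of_nonneg_right (by rw [hcL]; linarith) hT0.le
  -- (6) assembly
  have hbdry_total : V * (κ * ((2 / ly) * Φ s₂) + Φ s₂ * ((κ + 1) * L / lz₀)) ≤
      V * (C * T * Hm s + (ε - ε₁) * (a * C * T) * Hm s) := by
    refine mul_le_mul_of_nonneg_left ?_ hV.le
    -- `κ (2/ly) + (κ+1)L/lz₀ ≤ cL/lz₀`
    have hlz₀ly : 1 / ly ≤ 1 / lz₀ := by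
      refine one_div_le_one_div_of_le (by linarith) ?_
      calc lz₀ = ly ^ ((19:ℝ) / 20) := rfl
        _ ≤ ly ^ (1:ℝ) := Real.rpow_le_rpow_of_exponent_le hly1 (by norm_num)
        _ = ly := Real.rpow_one ly
    have hcoef : κ * (2 / ly) + (κ + 1) * L / lz₀ ≤ cL * (1 / lz₀) := by
      have h1 : κ * (2 / ly) ≤ 1 * (1 / lz₀) := by
        calc κ * (2 / ly) = (2 * κ) * (1 / ly) := by ring
          _ ≤ 1 * (1 / lz₀) := mul_le_mul (by linarith) hlz₀ly (by positivity) zero_le_one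
      have h2 : (κ + 1) * L / lz₀ = ((κ + 1) * L) * (1 / lz₀) := by ring
      have h3 : ((κ + 1) * L + 1) * (1 / lz₀) = ((κ + 1) * L) * (1 / lz₀) + 1 * (1 / lz₀) := by ring
      rw [h2, hcL, h3]; linarith
    have hΦs₂ := hΦ0 s₂ hs₂1
    calc κ * ((2 / ly) * Φ s₂) + Φ s₂ * ((κ + 1) * L / lz₀)
        = (κ * (2 / ly) + (κ + 1) * L / lz₀) * Φ s₂ := by ring
      _ ≤ (cL * (1 / lz₀)) * Φ s₂ := mul_le_mul_of_nonneg_right hcoef hΦs₂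
      _ ≤ (cL * (1 / lz₀)) * ((Real.log 2 / ly) ^ (-κ) * c₀ * (R * Hm s) +
            a * C * T * ((Real.log 2 / ly) ^ (-κ - 3 / 8) * (R * Hm s))) :=
          mul_le_mul_of_nonneg_left hbdry (mul_nonneg hcL0 (by positivity))
      _ = (cL * ((Real.log 2 / ly) ^ (-κ) * c₀ * R) * (1 / lz₀)) * Hm s +
            (cL * ((Real.log 2 / ly) ^ (-κ - 3 / 8) * R) * (1 / lz₀) * T) * (a * C) * Hm s := by ring
      _ ≤ (C * T) * Hm s + ((ε - ε₁) * T) * (a * C) * Hm s :=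
          add_le_add (mul_le_mul_of_nonneg_right hcoefA hHm.le)
            (mul_le_mul_of_nonneg_right (mul_le_mul_of_nonneg_right hcoefB (mul_nonneg ha hC0)) hHm.le)
      _ = C * T * Hm s + (ε - ε₁) * (a * C * T) * Hm s := by ring
  -- the integral split
  have hIsplit : ∫ t in s..s₀, Ψ t / t = (∫ t in s..s₂, Ψ t / t) + ∫ t in s₂..s₀, Ψ t / t :=
    (intervalIntegral.integral_add_adjacent_intervals (hΨint s s₂ le_rfl hss₂ hs₂s₀)
      (hΨint s₂ s₀ hss₂ hs₂s₀ le_rfl)).symm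
  have hgood' : ∑ p ∈ F.filter (fun p : ℕ => 2 * (p : ℝ) < y), g p * discT 1 g 1 (y / p) (primesProdBelow p) (N + 1) ≤
      s ^ (-κ) * (V * (contT 0 κ 1 (N + 2) s + a * C * T * ((1 + ε₁) * Hm s)) +
        V * (C * T * Hm s + (ε - ε₁) * (a * C * T) * Hm s)) := by
    refine hgood.trans ?_
    rw [hIsplit, mul_add κ, hmainI, hΨs]
    set I₁ := ∫ t in s..s₂, Ψ t / t with hI₁
    set I₂ := ∫ t in s₂..s₀, sieveKernel κ t * contT 1 κ 1 (N + 1) (t - 1) with hI₂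
    set I₃ := ∫ t in s₂..s₀, sieveKernel κ t * (1 - 1 / t) ^ (-(3 / 8 : ℝ)) * Hp (t - 1) with hI₃
    clear_value I₁ I₂ I₃
    have h1 : κ * I₁ ≤ κ * ((2 / ly) * Φ s₂) := mul_le_mul_of_nonneg_left hcap hκ.le
    have h2 : a * C * T * I₃ ≤ a * C * T * ((1 + ε₁) * Hm s) := mul_le_mul_of_nonneg_left hHpart haCT
    have hX : κ * I₁ + (I₂ + a * C * T * I₃) + Φ s₂ * ((κ + 1) * L / lz₀) ≤
        (contT 0 κ 1 (N + 2) s + a * C * T * ((1 + ε₁) * Hm s)) +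
          (κ * ((2 / ly) * Φ s₂) + Φ s₂ * ((κ + 1) * L / lz₀)) := by linarith [h1, hmain, h2]
    have hsum : V * (κ * I₁ + (I₂ + a * C * T * I₃) + Φ s₂ * ((κ + 1) * L / lz₀)) ≤
        V * (contT 0 κ 1 (N + 2) s + a * C * T * ((1 + ε₁) * Hm s)) +
          V * (κ * ((2 / ly) * Φ s₂) + Φ s₂ * ((κ + 1) * L / lz₀)) := by
      rw [← mul_add]; exact mul_le_mul_of_nonneg_left hX hV.le
    exact mul_le_mul_of_nonneg_left (hsum.trans (by linarith [hbdry_total])) (Real.rpow_nonneg hs0.le _)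
  -- final combination
  have hcoef : Ccr * (1 + L) + C + (a * C * (1 + ε₁) + C + (ε - ε₁) * (a * C)) ≤ (3 + (1 + ε) * a) * C := by
    have hkey : (3 + (1 + ε) * a) * C - (Ccr * (1 + L) + C + (a * C * (1 + ε₁) + C + (ε - ε₁) * (a * C))) =
        C - Ccr * (1 + L) := by ring
    linarith [hC2, hkey]
  calc discT 0 g 1 y (primesProdBelow z) (N + 2)
      = discT 0 g 1 y (primesProdBelow z₀) (N + 2) +
          (∑ p ∈ F.filter (fun p : ℕ => 2 * (p : ℝ) < y), g p * discT 1 g 1 (y / p) (primesProdBelow p) (N + 1) +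
            ∑ p ∈ F.filter (fun p : ℕ => ¬ 2 * (p : ℝ) < y), g p * discT 1 g 1 (y / p) (primesProdBelow p) (N + 1)) := by
        rw [← hsplit_sum]; linarith [hident]
    _ ≤ Ccr * (1 + L) * (V * s ^ (-κ) * (Hm s * T)) +
          (s ^ (-κ) * (V * (contT 0 κ 1 (N + 2) s + a * C * T * ((1 + ε₁) * Hm s)) +
            V * (C * T * Hm s + (ε - ε₁) * (a * C * T) * Hm s)) + C * (V * s ^ (-κ) * (Hm s * T))) :=
        add_le_add htrunc (add_le_add hgood' hbad)
    _ = V * s ^ (-κ) * (contT 0 κ 1 (N + 2) s +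
          (Ccr * (1 + L) + C + (a * C * (1 + ε₁) + C + (ε - ε₁) * (a * C))) * Hm s * T) := by ring
    _ ≤ V * s ^ (-κ) * (contT 0 κ 1 (N + 2) s + (3 + (1 + ε) * a) * C * Hm s * T) := by
        refine mul_le_mul_of_nonneg_left ?_ hVs
        have := mul_le_mul_of_nonneg_right (mul_le_mul_of_nonneg_right hcoef hHm.le) hT0.le
        linarith

end BetaSieve

end Literature.NumberTheory.Sieve

namespace Literature.NumberTheory.Sieve

namespace BetaSieve

open BetaSieveForward (sieveKernel sieveKernel_nonneg continuousOn_sieveKernel)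

variable {g : ArithmeticFunction ℝ} {κ L : ℝ}

/-! ### The upper-parity induction step at `β = 1`, range `s ≥ 2` -/

set_option maxHeartbeats 1600000 in
/-- **Induction step for `T⁺` at `β = 1` in the range `s ≥ 2`** (Iwaniec, §8, proof of Lemma 20, upper sign): if
the lower partial sums `T⁻_{N+1}` satisfy the inductive bound with amplitude `a` at every level, then `T⁺_{N+2}`
satisfies it with amplitude `2 + (1 + ε) a` for `z² ≤ y`, `y ≥ y₀`. The level is decomposed at
`z₀ = exp((log y)^{19/20})`; the first upper sum `T⁺_1(y, P(z))` vanishes for `z² ≤ y`; the primes `z₀ ≤ p < z` are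
peeled off ((4.5)), the inductive bound is inserted at `(y/p, p)` (`p² < y`), and Lemma 21 turns the sum into
`∫_s^{s₀} k(t) T⁻_{N+1}(t − 1) dt = T⁺_{N+2}(s) − T⁺_{N+2}(s₀)` ((7.3)) plus error terms; for `s ≥ 2` the weight
`(1 − 1/t)^{−κ−3/8}` is bounded by `2^{κ+3/8}`. [cite: IwaniecActaArith1980, Lemma 20 (proof, (8.5)–(8.9))] -/
theorem step_one_high_one {ε₁ R c₀ : ℝ} {Hp Hm : ℝ → ℝ}
    (hκ : 0 < κ) (hκ2 : κ ≤ 1 / 2) (hL : 0 ≤ L) (hR : 0 ≤ R) (hc₀ : 0 ≤ c₀)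
    (hHpos : ∀ s, 0 < Hp s ∧ 0 < Hm s) (hHm_anti : Antitone Hm) (hHm_cont : Continuous Hm)
    (hH2 : ∀ s U : ℝ, 2 ≤ s → s ≤ U →
      ∫ t in s..U, sieveKernel κ t * (1 - 1 / t) ^ (-(3 / 8 : ℝ)) * Hm (t - 1) ≤ (1 + ε₁) * Hp s)
    (hH3 : ∀ s, 2 ≤ s → Hm (s - 1) ≤ R * Hp s)
    (hH4 : ∀ (N : ℕ) (u : ℝ), 1 ≤ u → contT 0 κ 1 N u ≤ c₀ * Hm u)
    (hH6 : ∀ s, Real.exp (-s) ≤ Hp s)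
    (hg : g.IsMultiplicative) (hdim : HasIwaniecDimension g κ L)
    {Ccr yc : ℝ} (hCcr : 0 ≤ Ccr)
    (hcrude : ∀ y : ℝ, yc ≤ y → ∀ (par N : ℕ),
      discT par g 1 y (primesProdBelow (Real.exp (Real.log y ^ ((19:ℝ) / 20)))) N ≤
        Ccr * vprod g (primesProdBelow (Real.exp (Real.log y ^ ((19:ℝ) / 20)))) *
          (Real.log y ^ ((1:ℝ) / 20)) ^ (-κ) * Real.exp (-(Real.log y ^ ((1:ℝ) / 20))) * Real.log y ^ (-(3 / 8 : ℝ)))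
    {C ε y₀ : ℝ} (hC1 : 1 ≤ C) (hC2 : Ccr * (1 + L) ≤ C)
    (hC5 : (κ + 1) * L * (1 - 1 / (2:ℝ)) ^ (-κ - 3 / 8) * R * c₀ ≤ C)
    (hy₀c : yc ≤ y₀) (hy₀ : Real.exp (2 ^ 20) ≤ y₀)
    (hεh : ε₁ + (κ + 1) * L * (1 - 1 / (2:ℝ)) ^ (-κ - 3 / 8) * R * Real.log y₀ ^ (-((19:ℝ) / 20)) ≤ ε)
    {a : ℝ} (ha : 0 ≤ a) {N : ℕ}
    (hP0 : ∀ y z : ℝ, 2 ≤ z → z < y → Real.log y ^ ((19:ℝ) / 20) ≤ Real.log z →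
      discT 0 g 1 y (primesProdBelow z) (N + 1) ≤
        vprod g (primesProdBelow z) * (Real.log y / Real.log z) ^ (-κ) *
          (contT 0 κ 1 (N + 1) (Real.log y / Real.log z) +
            a * C * Hm (Real.log y / Real.log z) * Real.log y ^ (-(3 / 8 : ℝ)))) :
    ∀ y z : ℝ, y₀ ≤ y → 2 ≤ z → z ^ ((1:ℝ) + 1) ≤ y → Real.log y ^ ((19:ℝ) / 20) ≤ Real.log z →
      discT 1 g 1 y (primesProdBelow z) (N + 2) ≤
        vprod g (primesProdBelow z) * (Real.log y / Real.log z) ^ (-κ) *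
          (contT 1 κ 1 (N + 2) (Real.log y / Real.log z) +
            (2 + (1 + ε) * a) * C * Hp (Real.log y / Real.log z) * Real.log y ^ (-(3 / 8 : ℝ))) := by
  intro y z hy hz hzy hsz
  have hκ1 : κ < 1 := by linarith
  have hC0 : (0:ℝ) ≤ C := le_trans zero_le_one hC1
  have hyy : Real.exp (2 ^ 20) ≤ y := hy₀.trans hy
  obtain ⟨hy1, hly20, hs₀2, hmul, hz₀2, hz₀z, hs0, hss₀, h19, hdiv⟩ := level_facts_one hyy hz hsz
  set ly := Real.log y with hly
  set s₀ := ly ^ ((1:ℝ) / 20) with hs₀def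
  set lz₀ := ly ^ ((19:ℝ) / 20) with hlz₀def
  set z₀ := Real.exp lz₀ with hz₀def
  set s := ly / Real.log z with hsdef
  have h220 : (4:ℝ) ≤ 2 ^ 20 := by norm_num
  have hly4 : 4 ≤ ly := h220.trans hly20
  have hlypos : 0 < ly := by linarith
  have hly1 : 1 ≤ ly := by linarith
  have hs₀0 : 0 < s₀ := by linarith
  have hz1 : 1 < z := by linarith
  have hz0 : 0 < z := by linarith
  have hlogz : 0 < Real.log z := Real.log_pos hz1
  have hy0 : 0 < y := by linarith
  have htwo : (1:ℝ) + 1 = 2 := by norm_num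
  -- `2 ≤ s` from `z^2 ≤ y`, and `z < y`
  have h2s : 2 ≤ s := by
    rw [hsdef, le_div_iff₀ hlogz, ← htwo, ← Real.log_rpow hz0]
    exact Real.log_le_log (Real.rpow_pos_of_pos hz0 _) hzy
  have hs1 : 1 < s := by linarith
  have hzy' : z < y := by
    have : z < z ^ ((1:ℝ) + 1) := by
      calc z = z ^ (1:ℝ) := (Real.rpow_one z).symm
        _ < z ^ ((1:ℝ) + 1) := Real.rpow_lt_rpow_of_exponent_lt hz1 (by linarith)
    linarith
  have hlz₀ : Real.log z₀ = lz₀ := by rw [hz₀def, Real.log_exp]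
  have hlz₀1 : 1 ≤ lz₀ := h19
  set V := vprod g (primesProdBelow z) with hVdef
  have hV : 0 < V := hdim.vprod_pos z
  set bβ := (1 - 1 / (2:ℝ)) ^ (-κ - 3 / 8) with hbβ
  have hbβpos : 0 < bβ := Real.rpow_pos_of_pos (by norm_num) _
  set T := ly ^ (-(3 / 8 : ℝ)) with hT
  have hT0 : 0 < T := Real.rpow_pos_of_pos hlypos _
  have hHm := (hHpos s).1
  have hVs : 0 ≤ V * s ^ (-κ) := mul_nonneg hV.le (Real.rpow_nonneg hs0.le _)
  -- (1) decomposition at `z₀`; the first upper sums vanish (`z² ≤ y`) resp. are nonnegative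
  have hident := discT_one_succ_succ_sub hg 1 y hz₀z N
  have hT1z : bdrySum 1 g 1 y (primesProdBelow z) 1 = 0 := by
    rw [bdrySum_one_eq]
    refine Finset.sum_eq_zero fun p hp => if_neg ?_
    rintro ⟨-, hle⟩
    have hpz : (p : ℝ) < z := Nat.lt_ceil.mp (Nat.lt_of_mem_primesBelow hp)
    have hp0 : (0 : ℝ) ≤ p := Nat.cast_nonneg p
    have : (p : ℝ) ^ ((1:ℝ) + 1) < z ^ ((1:ℝ) + 1) := Real.rpow_lt_rpow hp0 hpz (by linarith)
    linarith
  have hT1z₀ : 0 ≤ bdrySum 1 g 1 y (primesProdBelow z₀) 1 :=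
    bdrySum_nonneg hg (squarefree_primesProdBelow z₀)
      (fun p hp => ⟨(hdim.1 p (Nat.prime_of_mem_primeFactors hp)).1,
        (hdim.1 p (Nat.prime_of_mem_primeFactors hp)).2.le⟩) 1 1 y 1
  -- (2) the truncated part
  have htrunc : discT 1 g 1 y (primesProdBelow z₀) (N + 2) ≤ Ccr * (1 + L) * (V * s ^ (-κ) * (Hp s * T)) := by
    have hcr : discT 1 g 1 y (primesProdBelow z₀) (N + 2) ≤
        Ccr * vprod g (primesProdBelow z₀) * s₀ ^ (-κ) * Real.exp (-s₀) * T := hcrude y (hy₀c.trans hy) 1 (N + 2)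
    have hV₀ : vprod g (primesProdBelow z₀) ≤ (s₀ / s) ^ κ * (1 + L / lz₀) * V := vprod_trunc_le_one hdim hyy hz hsz
    have hV₀pos : 0 < vprod g (primesProdBelow z₀) := hdim.vprod_pos z₀
    have h1 : Ccr * vprod g (primesProdBelow z₀) * s₀ ^ (-κ) * Real.exp (-s₀) * T ≤
        Ccr * ((s₀ / s) ^ κ * (1 + L / lz₀) * V) * s₀ ^ (-κ) * Real.exp (-s₀) * T :=
      mul_le_mul_of_nonneg_right (mul_le_mul_of_nonneg_right (mul_le_mul_of_nonneg_right
        (mul_le_mul_of_nonneg_left hV₀ hCcr) (Real.rpow_nonneg hs₀0.le _)) (Real.exp_pos _).le) hT0.le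
    have h2 : (s₀ / s) ^ κ * (1 + L / lz₀) * V * s₀ ^ (-κ) = (1 + L / lz₀) * (V * s ^ (-κ)) := by
      rw [← div_rpow_mul_rpow_neg hs0 hs₀0 κ]; ring
    have h3 : 1 + L / lz₀ ≤ 1 + L := by
      have : L / lz₀ ≤ L / 1 := div_le_div_of_nonneg_left hL one_pos hlz₀1
      rw [div_one] at this; linarith
    have h4 : Real.exp (-s₀) ≤ Hp s := (Real.exp_le_exp.mpr (neg_le_neg hss₀)).trans (hH6 s)
    calc discT 1 g 1 y (primesProdBelow z₀) (N + 2)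
        ≤ Ccr * vprod g (primesProdBelow z₀) * s₀ ^ (-κ) * Real.exp (-s₀) * T := hcr
      _ ≤ Ccr * ((s₀ / s) ^ κ * (1 + L / lz₀) * V) * s₀ ^ (-κ) * Real.exp (-s₀) * T := h1
      _ = Ccr * (1 + L / lz₀) * (V * s ^ (-κ)) * Real.exp (-s₀) * T := by
          rw [show Ccr * ((s₀ / s) ^ κ * (1 + L / lz₀) * V) * s₀ ^ (-κ) =
            Ccr * ((s₀ / s) ^ κ * (1 + L / lz₀) * V * s₀ ^ (-κ)) by ring, h2]; ring
      _ ≤ Ccr * (1 + L) * (V * s ^ (-κ)) * Hp s * T := by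
          refine mul_le_mul_of_nonneg_right (mul_le_mul (mul_le_mul_of_nonneg_right
            (mul_le_mul_of_nonneg_left h3 hCcr) hVs) h4 (Real.exp_pos _).le ?_) hT0.le
          exact mul_nonneg (mul_nonneg hCcr (by linarith)) hVs
      _ = Ccr * (1 + L) * (V * s ^ (-κ) * (Hp s * T)) := by ring
  -- (3) the peeled primes: the weight function `Φ`
  set F := (Nat.primesBelow ⌈z⌉₊).filter (fun p : ℕ => z₀ ≤ (p : ℝ)) with hFdef
  set Φ : ℝ → ℝ := fun t => (1 - 1 / t) ^ (-κ) * contT 0 κ 1 (N + 1) (t - 1) +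
    a * C * T * ((1 - 1 / t) ^ (-κ - 3 / 8) * Hm (t - 1)) with hΦdef
  have haCT : 0 ≤ a * C * T := mul_nonneg (mul_nonneg ha hC0) hT0.le
  have hΦ0 : ∀ t, 1 < t → 0 ≤ Φ t := by
    intro t ht
    have h1 : 0 ≤ (1 - 1 / t) ^ (-κ) := Real.rpow_nonneg (one_sub_inv_pos ht).le _
    have h2 : 0 ≤ (1 - 1 / t) ^ (-κ - 3 / 8) := Real.rpow_nonneg (one_sub_inv_pos ht).le _
    have h3 : 0 ≤ contT 0 κ 1 (N + 1) (t - 1) := contT_nonneg hκ.le le_rfl 0 (N + 1) (by linarith)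
    have h4 := (hHpos (t - 1)).2.le
    simp only [hΦdef]
    exact add_nonneg (mul_nonneg h1 h3) (mul_nonneg haCT (mul_nonneg h2 h4))
  have hΦm : AntitoneOn Φ (Icc s s₀) := by
    intro t ht t' ht' htt'
    have ht1 : 1 < t := by linarith [ht.1]
    have ht'1 : 1 < t' := by linarith [ht'.1]
    simp only [hΦdef]
    refine add_le_add ?_ (mul_le_mul_of_nonneg_left ?_ haCT)
    · refine mul_le_mul (one_sub_inv_rpow_antitone (by linarith) ht1 htt')
        (contT_antitoneOn_one hκ.le hκ1 0 (N + 1) (show (0:ℝ) ≤ t - 1 by linarith)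
          (show (0:ℝ) ≤ t' - 1 by linarith) (by linarith))
        (contT_nonneg hκ.le le_rfl 0 (N + 1) (by linarith)) (Real.rpow_nonneg (one_sub_inv_pos ht1).le _)
    · refine mul_le_mul (one_sub_inv_rpow_antitone (by linarith) ht1 htt') (hHm_anti (by linarith))
        (hHpos _).2.le (Real.rpow_nonneg (one_sub_inv_pos ht1).le _)
  have hΦc : ContinuousOn Φ (Icc s s₀) := by
    have hbase : ∀ r : ℝ, ContinuousOn (fun t : ℝ => (1 - 1 / t) ^ r) (Icc s s₀) := by
      intro r t ht
      have ht1 : 1 < t := by linarith [ht.1]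
      exact ((continuousAt_const.sub (continuousAt_const.div continuousAt_id (ne_of_gt (show (0:ℝ) < id t by
        simp only [id]; linarith)))).rpow_const (Or.inl (one_sub_inv_pos ht1).ne')).continuousWithinAt
    simp only [hΦdef]
    exact ((hbase (-κ)).mul ((continuous_contT_one hκ.le hκ1 0 (N + 1)).comp
      (continuous_id.sub continuous_const)).continuousOn).add
      (continuousOn_const.mul ((hbase (-κ - 3 / 8)).mul
        (hHm_cont.comp (continuous_id.sub continuous_const)).continuousOn))
  -- (3a) pointwise insertion of the inductive bound
  have hpt : ∀ p ∈ F,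
      (if (p : ℝ) ^ ((1:ℝ) + 1) < y then g p else 0) * discT 0 g 1 (y / p) (primesProdBelow p) (N + 1) ≤
        s ^ (-κ) * (g p * vprod g (primesProdBelow p) * ((Real.log p / Real.log z) ^ κ * Φ (ly / Real.log p))) := by
    intro p hp
    rw [hFdef, Finset.mem_filter, Nat.mem_primesBelow] at hp
    obtain ⟨⟨hpz, hpp⟩, hz₀p⟩ := hp
    have hpzR : (p : ℝ) < z := Nat.lt_ceil.mp hpz
    have hp2 : (2 : ℝ) ≤ p := hz₀2.trans hz₀p
    have hp1 : (1 : ℝ) < p := by linarith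
    have hp0 : (0 : ℝ) < p := by linarith
    have hpy : (p : ℝ) < y := hpzR.trans hzy'
    have hlogp : 0 < Real.log p := Real.log_pos hp1
    have hlogpz : Real.log p < Real.log z := Real.log_lt_log hp0 hpzR
    have hlogps₀ : lz₀ ≤ Real.log p := by
      have := Real.log_le_log (by linarith : (0:ℝ) < z₀) hz₀p
      rwa [hlz₀] at this
    set tp := ly / Real.log p with htp
    have htp_gt : s < tp := div_lt_div_of_pos_left hlypos hlogp hlogpz
    have htp_le : tp ≤ s₀ := by
      rw [htp, div_le_iff₀ hlogp, ← hdiv, div_mul_eq_mul_div, le_div_iff₀ (by linarith : (0:ℝ) < lz₀)]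
      exact mul_le_mul_of_nonneg_left hlogps₀ hlypos.le
    have htp1 : 1 < tp := by linarith
    have htp0 : 0 < tp := by linarith
    -- the inductive bound at `(y/p, p)`
    have hpβ1 : (p : ℝ) ^ ((1:ℝ) + 1) < y :=
      lt_of_lt_of_le (Real.rpow_lt_rpow hp0.le hpzR (by linarith)) hzy
    have hcond2 : (p : ℝ) < y / p := by
      rw [lt_div_iff₀ hp0]
      have : (p : ℝ) ^ ((1:ℝ) + 1) = p * p := by rw [Real.rpow_add_one hp0.ne', Real.rpow_one]
      linarith
    have hlogyp : Real.log (y / p) = ly - Real.log p := Real.log_div hy0.ne' hp0.ne'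
    have hlyp : ly - Real.log p = ly * (1 - 1 / tp) := by rw [htp]; field_simp
    have hcond3 : Real.log (y / p) ^ ((19:ℝ) / 20) ≤ Real.log p := region_div_one hy1 hz₀p hpy hp0
    have hind := hP0 (y / p) p hp2 hcond2 hcond3
    rw [hlogyp] at hind
    have hs' : (ly - Real.log p) / Real.log p = tp - 1 := by rw [htp]; field_simp
    rw [hs'] at hind
    have hnorm := rpow_neg_log_div_log_sub_one hy1 hz1 hp1 hpy κ
    rw [← htp, ← hsdef] at hnorm
    have hbase0 : 0 ≤ 1 - 1 / tp := (one_sub_inv_pos htp1).le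
    have hloge : (ly - Real.log p) ^ (-(3 / 8 : ℝ)) = T * (1 - 1 / tp) ^ (-(3 / 8 : ℝ)) := by
      rw [hlyp, Real.mul_rpow hlypos.le hbase0]
    rw [hnorm, hloge] at hind
    have hgp : 0 ≤ g p := (hdim.1 p hpp).1
    have hkey : vprod g (primesProdBelow p) * ((Real.log p / Real.log z) ^ κ * s ^ (-κ) * (1 - 1 / tp) ^ (-κ)) *
        (contT 0 κ 1 (N + 1) (tp - 1) + a * C * Hm (tp - 1) * (T * (1 - 1 / tp) ^ (-(3 / 8 : ℝ)))) =
        s ^ (-κ) * (vprod g (primesProdBelow p) * ((Real.log p / Real.log z) ^ κ * Φ tp)) := by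
      simp only [hΦdef]
      rw [show (-κ - 3 / 8 : ℝ) = -κ + -(3 / 8 : ℝ) by ring, Real.rpow_add (one_sub_inv_pos htp1)]
      ring
    rw [if_pos hpβ1]
    calc g p * discT 0 g 1 (y / p) (primesProdBelow p) (N + 1)
        ≤ g p * (vprod g (primesProdBelow p) * ((Real.log p / Real.log z) ^ κ * s ^ (-κ) * (1 - 1 / tp) ^ (-κ)) *
            (contT 0 κ 1 (N + 1) (tp - 1) + a * C * Hm (tp - 1) * (T * (1 - 1 / tp) ^ (-(3 / 8 : ℝ))))) :=
          mul_le_mul_of_nonneg_left hind hgp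
      _ = s ^ (-κ) * (g p * vprod g (primesProdBelow p) * ((Real.log p / Real.log z) ^ κ * Φ tp)) := by
          rw [hkey]; ring
  -- (3b) partial summation
  have hsum0 : ∑ p ∈ F, (if (p : ℝ) ^ ((1:ℝ) + 1) < y then g p else 0) * discT 0 g 1 (y / p) (primesProdBelow p) (N + 1) ≤
      s ^ (-κ) * (V * (κ * (∫ t in s..s₀, Φ t / t) + Φ s * ((κ + 1) * L / lz₀))) := by
    have h21 := sum_peeled_le hdim hκ.le hy1 hz₀2 hz₀z (Φ := Φ)
      (fun t ht => hΦ0 t (by rw [← hly, ← hsdef] at ht; linarith [ht.1]))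
      (by rw [← hly, ← hsdef, hlz₀, hdiv]; exact hΦm)
      (by rw [← hly, ← hsdef, hlz₀, hdiv]; exact hΦc)
    rw [← hly, ← hsdef, hlz₀, hdiv, ← hVdef, ← hFdef] at h21
    calc ∑ p ∈ F, (if (p : ℝ) ^ ((1:ℝ) + 1) < y then g p else 0) * discT 0 g 1 (y / p) (primesProdBelow p) (N + 1)
        ≤ ∑ p ∈ F, s ^ (-κ) * (g p * vprod g (primesProdBelow p) * ((Real.log p / Real.log z) ^ κ * Φ (ly / Real.log p))) :=
          Finset.sum_le_sum hpt
      _ = s ^ (-κ) * ∑ p ∈ F, g p * vprod g (primesProdBelow p) * ((Real.log p / Real.log z) ^ κ * Φ (ly / Real.log p)) := by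
          rw [Finset.mul_sum]
      _ ≤ s ^ (-κ) * (V * (κ * (∫ t in s..s₀, Φ t / t) + Φ s * ((κ + 1) * L / lz₀))) :=
          mul_le_mul_of_nonneg_left h21 (Real.rpow_nonneg hs0.le _)
  -- (3c) the integral: main part and `H`-part
  have hint_eval : κ * (∫ t in s..s₀, Φ t / t) =
      (∫ t in s..s₀, sieveKernel κ t * contT 0 κ 1 (N + 1) (t - 1)) +
        a * C * T * ∫ t in s..s₀, sieveKernel κ t * (1 - 1 / t) ^ (-(3 / 8 : ℝ)) * Hm (t - 1) := by
    have hi1 : IntervalIntegrable (fun t => sieveKernel κ t * contT 0 κ 1 (N + 1) (t - 1)) volume s s₀ :=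
      intervalIntegrable_sieveKernel_mul_of_one_le hκ1 (continuous_contT_one hκ.le hκ1 0 (N + 1)) hs1.le hss₀
    have hi2 : IntervalIntegrable (fun t => sieveKernel κ t * (1 - 1 / t) ^ (-(3 / 8 : ℝ)) * Hm (t - 1)) volume s s₀ := by
      refine ContinuousOn.intervalIntegrable ?_
      rw [uIcc_of_le hss₀]
      exact ((continuousOn_sieveKernel_mul_rpow κ (3 / 8)).mono fun t ht => show (1:ℝ) < t by linarith [ht.1]).mul
        (hHm_cont.comp (continuous_id.sub continuous_const)).continuousOn
    rw [← intervalIntegral.integral_const_mul, ← intervalIntegral.integral_const_mul,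
      ← intervalIntegral.integral_add hi1 (hi2.const_mul _)]
    refine intervalIntegral.integral_congr fun t ht => ?_
    rw [uIcc_of_le hss₀] at ht
    have ht1 : 1 < t := by linarith [ht.1]
    have ht0 : (0:ℝ) < t := by linarith
    simp only [hΦdef]
    rw [sieveKernel_mul_rpow_eq ht1, sieveKernel_eq_of_one_lt ht1]
    field_simp
  have hmain : ∫ t in s..s₀, sieveKernel κ t * contT 0 κ 1 (N + 1) (t - 1) ≤ contT 1 κ 1 (N + 2) s := by
    rw [← contT_one_sub_eq_integral_one hκ.le hκ1 N h2s hss₀]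
    linarith [contT_nonneg hκ.le le_rfl 1 (N + 2) (show (0:ℝ) ≤ s₀ by linarith)]
  have hHpart : ∫ t in s..s₀, sieveKernel κ t * (1 - 1 / t) ^ (-(3 / 8 : ℝ)) * Hm (t - 1) ≤ (1 + ε₁) * Hp s :=
    hH2 s s₀ h2s hss₀
  -- (3d) the boundary term
  have hbdry : Φ s ≤ bβ * (c₀ + a * C * T) * (R * Hp s) := by
    have h1 : (1 - 1 / s) ^ (-κ) ≤ (1 - 1 / s) ^ (-κ - 3 / 8) := one_sub_inv_rpow_le_rpow (by norm_num) hs1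
    have h2 : (1 - 1 / s) ^ (-κ - 3 / 8) ≤ bβ := one_sub_inv_rpow_le (by linarith) one_lt_two h2s
    have h3 : contT 0 κ 1 (N + 1) (s - 1) ≤ c₀ * Hm (s - 1) := hH4 (N + 1) (s - 1) (by linarith)
    have h4 : Hm (s - 1) ≤ R * Hp s := hH3 s h2s
    have hT1 : 0 ≤ contT 0 κ 1 (N + 1) (s - 1) := contT_nonneg hκ.le le_rfl 0 (N + 1) (by linarith)
    have hHp0 := (hHpos (s - 1)).2.le
    have hr0 : 0 ≤ (1 - 1 / s) ^ (-κ) := Real.rpow_nonneg (one_sub_inv_pos hs1).le _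
    simp only [hΦdef]
    calc (1 - 1 / s) ^ (-κ) * contT 0 κ 1 (N + 1) (s - 1) + a * C * T * ((1 - 1 / s) ^ (-κ - 3 / 8) * Hm (s - 1))
        ≤ bβ * (c₀ * Hm (s - 1)) + a * C * T * (bβ * Hm (s - 1)) :=
          add_le_add (mul_le_mul (h1.trans h2) h3 hT1 hbβpos.le)
            (mul_le_mul_of_nonneg_left (mul_le_mul_of_nonneg_right h2 hHp0) haCT)
      _ = bβ * (c₀ + a * C * T) * Hm (s - 1) := by ring
      _ ≤ bβ * (c₀ + a * C * T) * (R * Hp s) :=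
          mul_le_mul_of_nonneg_left h4 (mul_nonneg hbβpos.le (add_nonneg hc₀ haCT))
  -- (4) assembly of the error terms
  have hly₀le : Real.log y₀ ≤ ly := Real.log_le_log (by linarith [Real.exp_pos ((2:ℝ) ^ 20)]) hy
  have hly₀pos : 0 < Real.log y₀ := by
    have : (2:ℝ) ^ 20 ≤ Real.log y₀ := by
      rw [Real.le_log_iff_exp_le (by linarith [Real.exp_pos ((2:ℝ) ^ 20)])]; exact hy₀
    linarith
  have h1920 : 1 / lz₀ = ly ^ (-((19:ℝ) / 20)) := by rw [hlz₀def, Real.rpow_neg hlypos.le, one_div]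
  have hs₀T : (κ + 1) * L * bβ * R * c₀ / lz₀ ≤ C * T := by
    have hpow : ly ^ (-((19:ℝ) / 20)) = ly ^ (3 / 8 - 19 / 20 : ℝ) * T := by
      rw [hT, ← Real.rpow_add hlypos]; ring_nf
    have hexp : ly ^ (3 / 8 - 19 / 20 : ℝ) ≤ 1 := Real.rpow_le_one_of_one_le_of_nonpos hly1 (by norm_num)
    have hK0 : 0 ≤ (κ + 1) * L * bβ * R * c₀ :=
      mul_nonneg (mul_nonneg (mul_nonneg (mul_nonneg (by linarith) hL) hbβpos.le) hR) hc₀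
    calc (κ + 1) * L * bβ * R * c₀ / lz₀ = ((κ + 1) * L * bβ * R * c₀) * (1 / lz₀) := by ring
      _ = ((κ + 1) * L * bβ * R * c₀) * ly ^ (3 / 8 - 19 / 20 : ℝ) * T := by rw [h1920, hpow]; ring
      _ ≤ C * 1 * T := mul_le_mul_of_nonneg_right (mul_le_mul hC5 hexp (Real.rpow_nonneg hlypos.le _) hC0) hT0.le
      _ = C * T := by ring
  have hεT : ε₁ + (κ + 1) * L * bβ * R / lz₀ ≤ ε := by
    have hmono : ly ^ (-((19:ℝ) / 20)) ≤ Real.log y₀ ^ (-((19:ℝ) / 20)) :=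
      Real.rpow_le_rpow_of_nonpos hly₀pos hly₀le (by norm_num)
    have : (κ + 1) * L * bβ * R / lz₀ ≤ (κ + 1) * L * bβ * R * Real.log y₀ ^ (-((19:ℝ) / 20)) := by
      rw [div_eq_mul_one_div, h1920]
      exact mul_le_mul_of_nonneg_left hmono (mul_nonneg (mul_nonneg (mul_nonneg (by linarith) hL) hbβpos.le) hR)
    linarith
  -- final combination
  have hsum := hsum0
  rw [hint_eval] at hsum
  set I₂ := ∫ t in s..s₀, sieveKernel κ t * contT 0 κ 1 (N + 1) (t - 1) with hI₂
  set I₃ := ∫ t in s..s₀, sieveKernel κ t * (1 - 1 / t) ^ (-(3 / 8 : ℝ)) * Hm (t - 1) with hI₃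
  clear_value I₂ I₃
  have hE : V * ((I₂ + a * C * T * I₃) + Φ s * ((κ + 1) * L / lz₀)) ≤
      V * (contT 1 κ 1 (N + 2) s + (a * C * T * (1 + ε₁) + (κ + 1) * L * bβ * R * (c₀ + a * C * T) / lz₀) * Hp s) := by
    refine mul_le_mul_of_nonneg_left ?_ hV.le
    have h1 : a * C * T * I₃ ≤ a * C * T * ((1 + ε₁) * Hp s) := mul_le_mul_of_nonneg_left hHpart haCT
    have h2 : Φ s * ((κ + 1) * L / lz₀) ≤ bβ * (c₀ + a * C * T) * (R * Hp s) * ((κ + 1) * L / lz₀) :=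
      mul_le_mul_of_nonneg_right hbdry (div_nonneg (mul_nonneg (by linarith) hL) (by linarith))
    have h3 : bβ * (c₀ + a * C * T) * (R * Hp s) * ((κ + 1) * L / lz₀) =
        (κ + 1) * L * bβ * R * (c₀ + a * C * T) / lz₀ * Hp s := by ring
    linarith [h1, h2, h3, hmain]
  have hcoef : Ccr * (1 + L) * T + (a * C * T * (1 + ε₁) + (κ + 1) * L * bβ * R * (c₀ + a * C * T) / lz₀) ≤
      (2 + (1 + ε) * a) * C * T := by
    have h1 : Ccr * (1 + L) * T ≤ C * T := mul_le_mul_of_nonneg_right hC2 hT0.le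
    have h2 : (κ + 1) * L * bβ * R * (c₀ + a * C * T) / lz₀ =
        (κ + 1) * L * bβ * R * c₀ / lz₀ + ((κ + 1) * L * bβ * R / lz₀) * (a * C * T) := by ring
    have h3 : ((κ + 1) * L * bβ * R / lz₀) * (a * C * T) ≤ (ε - ε₁) * (a * C * T) :=
      mul_le_mul_of_nonneg_right (by linarith) haCT
    rw [h2]
    have hkey : (2 + (1 + ε) * a) * C * T - (C * T + (a * C * T * (1 + ε₁) + (C * T + (ε - ε₁) * (a * C * T)))) = 0 := by
      ring
    linarith [h1, hs₀T, h3, hkey]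
  calc discT 1 g 1 y (primesProdBelow z) (N + 2)
      ≤ discT 1 g 1 y (primesProdBelow z₀) (N + 2) +
          ∑ p ∈ F, (if (p : ℝ) ^ ((1:ℝ) + 1) < y then g p else 0) * discT 0 g 1 (y / p) (primesProdBelow p) (N + 1) := by
        linarith [hident, hT1z, hT1z₀]
    _ ≤ Ccr * (1 + L) * (V * s ^ (-κ) * (Hp s * T)) +
          s ^ (-κ) * (V * (contT 1 κ 1 (N + 2) s +
            (a * C * T * (1 + ε₁) + (κ + 1) * L * bβ * R * (c₀ + a * C * T) / lz₀) * Hp s)) := by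
        have := mul_le_mul_of_nonneg_left hE (Real.rpow_nonneg hs0.le (-κ))
        linarith [htrunc, hsum]
    _ = V * s ^ (-κ) * (contT 1 κ 1 (N + 2) s +
          (Ccr * (1 + L) * T + (a * C * T * (1 + ε₁) + (κ + 1) * L * bβ * R * (c₀ + a * C * T) / lz₀)) * Hp s) := by
        ring
    _ ≤ V * s ^ (-κ) * (contT 1 κ 1 (N + 2) s + (2 + (1 + ε) * a) * C * T * Hp s) :=
        mul_le_mul_of_nonneg_left (by linarith [mul_le_mul_of_nonneg_right hcoef hHm.le]) hVs
    _ = V * s ^ (-κ) * (contT 1 κ 1 (N + 2) s + (2 + (1 + ε) * a) * C * Hp s * T) := by ring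

end BetaSieve

end Literature.NumberTheory.Sieve

namespace Literature.NumberTheory.Sieve

namespace BetaSieve

open BetaSieveForward (sieveKernel sieveKernel_nonneg continuousOn_sieveKernel)

variable {g : ArithmeticFunction ℝ} {κ L : ℝ}

/-! ### The upper-parity step in the range `1 < y < z²` ((4.6) and (8.3)) at `β = 1` -/

/-- **The upper bound below `s = 2` at `β = 1`** (Iwaniec (4.6) with (8.3) and the third line of (7.3)): if
`T⁺_N(y, P(z))` obeys the inductive bound with amplitude `a` whenever `z² ≤ y` (levels `y ≥ y₀` in the region
`(log y)^{19/20} ≤ log z`), then for `1 < y < z²` (any `z ≥ 2`, possibly `z > y`) it obeys it with amplitude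
`1 + (1 + ε) a`: `T⁺_N(y, P(z)) = T⁺_1(y, P(z)) + T⁺_N(y, P(√y))`, the first term is at most
`V s^{−κ}{2^κ − s^κ + 2^{κ+1} L/log y}`, the second is the case `s = 2`, and `T⁺_N(s) = 2^κ − s^κ + T⁺_N(2)`.
[cite: IwaniecActaArith1980, (4.6), (8.3) and (7.3)] -/
theorem step_one_low_one {c₀ : ℝ} {Hp : ℝ → ℝ}
    (hκ : 0 < κ) (hL : 0 ≤ L) (hc₀ : 0 ≤ c₀)
    (hHpos : ∀ s, 0 < Hp s) (hHp_anti : Antitone Hp)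
    (hH4 : ∀ (N : ℕ) (u : ℝ), 0 ≤ u → contT 1 κ 1 N u ≤ c₀ * Hp u)
    (hg : g.IsMultiplicative) (hdim : HasIwaniecDimension g κ L)
    {C ε y₀ : ℝ} (hC1 : 1 ≤ C) (hε0 : 0 ≤ ε) (hy₀ : Real.exp (2 ^ 20) ≤ y₀)
    (hy₀6 : L * 2 ^ (κ + 1) * Real.log y₀ ^ ((3:ℝ) / 8 - 1) ≤ Hp 2 / 2)
    (hy₀7 : L * 2 * c₀ * Real.log y₀ ^ ((3:ℝ) / 8 - 1) ≤ 1 / 2)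
    (hε4 : L * 2 / Real.log y₀ ≤ ε)
    {a : ℝ} (ha : 0 ≤ a) {N : ℕ} (hN : 1 ≤ N)
    (hHigh : ∀ y z : ℝ, y₀ ≤ y → 2 ≤ z → z ^ ((1:ℝ) + 1) ≤ y → Real.log y ^ ((19:ℝ) / 20) ≤ Real.log z →
      discT 1 g 1 y (primesProdBelow z) N ≤
        vprod g (primesProdBelow z) * (Real.log y / Real.log z) ^ (-κ) *
          (contT 1 κ 1 N (Real.log y / Real.log z) + a * C * Hp (Real.log y / Real.log z) * Real.log y ^ (-(3 / 8 : ℝ)))) :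
    ∀ y z : ℝ, y₀ ≤ y → 2 ≤ z → 1 < y → y < z ^ ((1:ℝ) + 1) →
      discT 1 g 1 y (primesProdBelow z) N ≤
        vprod g (primesProdBelow z) * (Real.log y / Real.log z) ^ (-κ) *
          (contT 1 κ 1 N (Real.log y / Real.log z) +
            (1 + (1 + ε) * a) * C * Hp (Real.log y / Real.log z) * Real.log y ^ (-(3 / 8 : ℝ))) := by
  intro y z hy hz hy1 hyz
  have hC0 : (0:ℝ) ≤ C := le_trans zero_le_one hC1
  have hyy : Real.exp (2 ^ 20) ≤ y := hy₀.trans hy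
  have hy0 : 0 < y := by linarith
  have hy₀0 : 0 < y₀ := lt_of_lt_of_le (Real.exp_pos _) hy₀
  have hly20 : (2:ℝ) ^ 20 ≤ Real.log y := by rw [Real.le_log_iff_exp_le hy0]; exact hyy
  set ly := Real.log y with hly
  have h220 : (4:ℝ) ≤ 2 ^ 20 := by norm_num
  have hly4 : 4 ≤ ly := h220.trans hly20
  have hlypos : 0 < ly := by linarith
  have hly₀le : Real.log y₀ ≤ ly := Real.log_le_log hy₀0 hy
  have hly₀pos : 0 < Real.log y₀ := by
    have : (2:ℝ) ^ 20 ≤ Real.log y₀ := by rw [Real.le_log_iff_exp_le hy₀0]; exact hy₀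
    linarith
  have hz1 : 1 < z := by linarith
  have hz0 : 0 < z := by linarith
  have hlogz : 0 < Real.log z := Real.log_pos hz1
  set s := ly / Real.log z with hsdef
  have hs0 : 0 < s := div_pos hlypos hlogz
  have htwo : (1:ℝ) + 1 = 2 := by norm_num
  have hβ1 : (0:ℝ) < 1 + 1 := by norm_num
  have hsβ : s < 2 := by
    rw [hsdef, div_lt_iff₀ hlogz, ← htwo, ← Real.log_rpow hz0]
    exact Real.log_lt_log hy0 hyz
  -- `z₁ = y^{1/2}`
  set z₁ := y ^ (1 / ((1:ℝ) + 1)) with hz₁def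
  have hlogz₁ : Real.log z₁ = ly / 2 := by rw [hz₁def, Real.log_rpow hy0]; ring
  have hz₁pos : 0 < z₁ := Real.rpow_pos_of_pos hy0 _
  have hlogz₁ge : 2 ≤ Real.log z₁ := by rw [hlogz₁]; linarith
  have hz₁2 : 2 ≤ z₁ := by
    have h2 : (2:ℝ) ≤ Real.exp 2 := by linarith [Real.add_one_le_exp (2:ℝ)]
    calc (2:ℝ) ≤ Real.exp 2 := h2
      _ ≤ Real.exp (Real.log z₁) := Real.exp_le_exp.mpr hlogz₁ge
      _ = z₁ := Real.exp_log hz₁pos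
  have hz₁z : z₁ ≤ z := by
    have h := Real.rpow_le_rpow hy0.le hyz.le (one_div_nonneg.mpr hβ1.le)
    rw [one_div, Real.rpow_rpow_inv hz0.le hβ1.ne'] at h
    show y ^ (1 / ((1:ℝ) + 1)) ≤ z
    rw [one_div]; exact h
  have hz₁y : z₁ ^ ((1:ℝ) + 1) = y := by
    rw [hz₁def, one_div, Real.rpow_inv_rpow hy0.le hβ1.ne']
  -- the region at `(y, z₁)`: `ly^{19/20} ≤ ly/2` since `ly^{1/20} ≥ 2`
  have hregion : Real.log y ^ ((19:ℝ) / 20) ≤ Real.log z₁ := by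
    rw [hlogz₁, ← hly]
    have hs₀2 : 2 ≤ ly ^ ((1:ℝ) / 20) := by
      have h : ((2:ℝ) ^ 20) ^ ((1:ℝ) / 20) = 2 := by
        rw [show ((2:ℝ) ^ 20) = (2:ℝ) ^ ((20:ℕ):ℝ) by norm_num, ← Real.rpow_mul (by norm_num)]; norm_num
      rw [← h]
      exact Real.rpow_le_rpow (by norm_num) hly20 (by norm_num)
    have hmul : ly ^ ((1:ℝ) / 20) * ly ^ ((19:ℝ) / 20) = ly := by
      rw [← Real.rpow_add hlypos]; norm_num
    have h19 : 0 ≤ ly ^ ((19:ℝ) / 20) := Real.rpow_nonneg hlypos.le _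
    nlinarith
  -- the decomposition (4.6) and the two bounds
  have hsplit := discT_one_eq_add hg hy0.le hβ1 hz₁z hN
  have hT1 := bdrySum_one_one_le hdim hy0 hβ1 hz₁2 hz₁z
  rw [← hly, ← hsdef, htwo] at hT1
  have hhigh := hHigh y z₁ hy hz₁2 hz₁y.le hregion
  have hsz₁ : ly / Real.log z₁ = 2 := by rw [hlogz₁]; field_simp
  rw [← hly, hsz₁] at hhigh
  set V := vprod g (primesProdBelow z) with hVdef
  have hV : 0 < V := hdim.vprod_pos z
  have hV₁ := hdim.vprod_le hz₁2 hz₁z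
  have hratio : Real.log z / Real.log z₁ = 2 / s := by
    rw [hlogz₁, hsdef]; field_simp
  rw [hratio, ← hVdef] at hV₁
  set T := ly ^ (-(3 / 8 : ℝ)) with hT
  have hT0 : 0 < T := Real.rpow_pos_of_pos hlypos _
  have h20 : (0:ℝ) < 2 := two_pos
  -- `V(z₁) 2^{-κ} ≤ s^{-κ} (1 + 2L/ly) V`
  have hV₁' : vprod g (primesProdBelow z₁) * (2:ℝ) ^ (-κ) ≤ (1 + L / Real.log z₁) * (V * s ^ (-κ)) := by
    have h := mul_le_mul_of_nonneg_right hV₁ (Real.rpow_nonneg h20.le (-κ))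
    calc vprod g (primesProdBelow z₁) * (2:ℝ) ^ (-κ)
        ≤ ((2:ℝ) / s) ^ κ * (1 + L / Real.log z₁) * V * (2:ℝ) ^ (-κ) := h
      _ = (1 + L / Real.log z₁) * (V * (((2:ℝ) / s) ^ κ * (2:ℝ) ^ (-κ))) := by ring
      _ = (1 + L / Real.log z₁) * (V * s ^ (-κ)) := by rw [div_rpow_mul_rpow_neg hs0 h20 κ]
  have hLz₁ : L / Real.log z₁ = L * 2 / ly := by rw [hlogz₁]; field_simp
  rw [hLz₁] at hV₁'
  have hsmall : L * 2 / ly ≤ ε := by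
    calc L * 2 / ly ≤ L * 2 / Real.log y₀ := div_le_div_of_nonneg_left (by positivity) hly₀pos hly₀le
      _ ≤ ε := hε4
  -- error bookkeeping
  have hHβ := hHpos 2
  have hHs : Hp 2 ≤ Hp s := hHp_anti hsβ.le
  have hmono : ly ^ ((3:ℝ) / 8 - 1) ≤ Real.log y₀ ^ ((3:ℝ) / 8 - 1) :=
    Real.rpow_le_rpow_of_nonpos hly₀pos hly₀le (by norm_num)
  have hsplit_exp : 1 / ly = ly ^ ((3:ℝ) / 8 - 1) * T := by
    rw [hT, ← Real.rpow_add hlypos, one_div, ← Real.rpow_neg_one]; norm_num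
  have herr1 : L * 2 ^ (κ + 1) / ly ≤ 1 / 2 * C * Hp 2 * T := by
    have h1 : L * 2 ^ (κ + 1) * ly ^ ((3:ℝ) / 8 - 1) ≤ Hp 2 / 2 :=
      le_trans (mul_le_mul_of_nonneg_left hmono (mul_nonneg hL (Real.rpow_nonneg h20.le _))) hy₀6
    calc L * 2 ^ (κ + 1) / ly = (L * 2 ^ (κ + 1) * ly ^ ((3:ℝ) / 8 - 1)) * T := by
          rw [div_eq_mul_one_div, hsplit_exp]; ring
      _ ≤ Hp 2 / 2 * T := mul_le_mul_of_nonneg_right h1 hT0.le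
      _ = 1 / 2 * 1 * Hp 2 * T := by ring
      _ ≤ 1 / 2 * C * Hp 2 * T :=
          mul_le_mul_of_nonneg_right (mul_le_mul_of_nonneg_right
            (mul_le_mul_of_nonneg_left hC1 (by norm_num)) hHβ.le) hT0.le
  have herr2 : L * 2 / ly * contT 1 κ 1 N 2 ≤ 1 / 2 * C * Hp 2 * T := by
    have h1 : L * 2 * c₀ * ly ^ ((3:ℝ) / 8 - 1) ≤ 1 / 2 :=
      le_trans (mul_le_mul_of_nonneg_left hmono (mul_nonneg (mul_nonneg hL h20.le) hc₀)) hy₀7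
    have h2 : contT 1 κ 1 N 2 ≤ c₀ * Hp 2 := hH4 N 2 (by norm_num)
    have h3 : 0 ≤ L * 2 / ly := div_nonneg (mul_nonneg hL h20.le) hlypos.le
    calc L * 2 / ly * contT 1 κ 1 N 2 ≤ L * 2 / ly * (c₀ * Hp 2) := mul_le_mul_of_nonneg_left h2 h3
      _ = (L * 2 * c₀ * ly ^ ((3:ℝ) / 8 - 1)) * Hp 2 * T := by
          rw [div_eq_mul_one_div, hsplit_exp]; ring
      _ ≤ 1 / 2 * Hp 2 * T := mul_le_mul_of_nonneg_right (mul_le_mul_of_nonneg_right h1 hHβ.le) hT0.le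
      _ = 1 / 2 * 1 * Hp 2 * T := by ring
      _ ≤ 1 / 2 * C * Hp 2 * T :=
          mul_le_mul_of_nonneg_right (mul_le_mul_of_nonneg_right
            (mul_le_mul_of_nonneg_left hC1 (by norm_num)) hHβ.le) hT0.le
  have herr3 : (1 + L * 2 / ly) * (a * C * Hp 2 * T) ≤ (1 + ε) * (a * C * Hp 2 * T) :=
    mul_le_mul_of_nonneg_right (by linarith) (mul_nonneg (mul_nonneg (mul_nonneg ha hC0) hHβ.le) hT0.le)
  have hcontT := contT_one_eq_of_le (κ := κ) (β := 1) hN (show s ≤ 1 + 1 by linarith)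
  rw [htwo] at hcontT
  -- assembly
  have hhigh' : discT 1 g 1 y (primesProdBelow z₁) N ≤
      (1 + L * 2 / ly) * (V * s ^ (-κ)) * (contT 1 κ 1 N 2 + a * C * Hp 2 * T) := by
    refine hhigh.trans ?_
    have h0 : 0 ≤ contT 1 κ 1 N 2 + a * C * Hp 2 * T :=
      add_nonneg (contT_nonneg hκ.le le_rfl 1 N (by norm_num))
        (mul_nonneg (mul_nonneg (mul_nonneg ha hC0) hHβ.le) hT0.le)
    exact mul_le_mul_of_nonneg_right hV₁' h0
  have hVs : 0 ≤ V * s ^ (-κ) := mul_nonneg hV.le (Real.rpow_nonneg hs0.le _)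
  have hT1' : bdrySum 1 g 1 y (primesProdBelow z) 1 ≤
      V * s ^ (-κ) * ((2:ℝ) ^ κ - s ^ κ + L * 2 ^ (κ + 1) / ly) := hT1
  have hcT0 : 0 ≤ contT 1 κ 1 N 2 := contT_nonneg hκ.le le_rfl 1 N (by norm_num)
  calc discT 1 g 1 y (primesProdBelow z) N
      = bdrySum 1 g 1 y (primesProdBelow z) 1 + discT 1 g 1 y (primesProdBelow z₁) N := hsplit
    _ ≤ V * s ^ (-κ) * ((2:ℝ) ^ κ - s ^ κ + L * 2 ^ (κ + 1) / ly) +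
          (1 + L * 2 / ly) * (V * s ^ (-κ)) * (contT 1 κ 1 N 2 + a * C * Hp 2 * T) :=
        add_le_add hT1' hhigh'
    _ = V * s ^ (-κ) * (((2:ℝ) ^ κ - s ^ κ + contT 1 κ 1 N 2) +
          (L * 2 ^ (κ + 1) / ly + L * 2 / ly * contT 1 κ 1 N 2 +
            (1 + L * 2 / ly) * (a * C * Hp 2 * T))) := by ring
    _ ≤ V * s ^ (-κ) * (contT 1 κ 1 N s + (1 + (1 + ε) * a) * C * Hp s * T) := by
        refine mul_le_mul_of_nonneg_left ?_ hVs
        rw [hcontT]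
        have hsum : L * 2 ^ (κ + 1) / ly + L * 2 / ly * contT 1 κ 1 N 2 +
            (1 + L * 2 / ly) * (a * C * Hp 2 * T) ≤ (1 + (1 + ε) * a) * C * Hp 2 * T := by
          have hkey : (1 + (1 + ε) * a) * C * Hp 2 * T =
              1 / 2 * C * Hp 2 * T + 1 / 2 * C * Hp 2 * T + (1 + ε) * (a * C * Hp 2 * T) := by ring
          linarith [herr1, herr2, herr3, hkey]
        have hpos1 : 0 ≤ (1 + (1 + ε) * a) * C :=
          mul_nonneg (add_nonneg zero_le_one (mul_nonneg (by linarith) ha)) hC0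
        have hmonoH : (1 + (1 + ε) * a) * C * Hp 2 * T ≤ (1 + (1 + ε) * a) * C * Hp s * T :=
          mul_le_mul_of_nonneg_right (mul_le_mul_of_nonneg_left hHs hpos1) hT0.le
        linarith

/-! ### Small levels `y < y₀` at `β = 1` -/

/-- **`V(P(z)) (log z)^κ ≥ (log 2)^κ/(1 + L/log 2)`** for `z ≥ 2` under `Ω(κ, L)` (the case `w = 2` of the
dimension condition). [folklore] -/
theorem vprod_mul_log_rpow_ge (hdim : HasIwaniecDimension g κ L) {z : ℝ} (hz : 2 ≤ z) :
    Real.log 2 ^ κ / (1 + L / Real.log 2) ≤ vprod g (primesProdBelow z) * Real.log z ^ κ := by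
  have hL : 0 ≤ L := hdim.nonneg
  have hlog2 : 0 < Real.log 2 := Real.log_pos one_lt_two
  have hlogz : 0 ≤ Real.log z := Real.log_nonneg (by linarith)
  have hV : 0 < vprod g (primesProdBelow z) := hdim.vprod_pos z
  have hA0 : 0 < 1 + L / Real.log 2 := by positivity
  have hl2κ : 0 < Real.log 2 ^ κ := Real.rpow_pos_of_pos hlog2 κ
  have hVinv := hdim.inv_vprod_le hz
  have h1 : 1 ≤ vprod g (primesProdBelow z) * ((Real.log z / Real.log 2) ^ κ * (1 + L / Real.log 2)) := by
    calc (1:ℝ) = vprod g (primesProdBelow z) * (vprod g (primesProdBelow z))⁻¹ := (mul_inv_cancel₀ hV.ne').symm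
      _ ≤ _ := mul_le_mul_of_nonneg_left hVinv hV.le
  rw [Real.div_rpow hlogz hlog2.le] at h1
  have h2 : Real.log 2 ^ κ ≤ vprod g (primesProdBelow z) * Real.log z ^ κ * (1 + L / Real.log 2) := by
    have := mul_le_mul_of_nonneg_right h1 hl2κ.le
    rw [one_mul] at this
    calc Real.log 2 ^ κ ≤ vprod g (primesProdBelow z) * (Real.log z ^ κ / Real.log 2 ^ κ * (1 + L / Real.log 2)) *
        Real.log 2 ^ κ := this
      _ = vprod g (primesProdBelow z) * Real.log z ^ κ * (1 + L / Real.log 2) := by field_simp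
  rw [div_le_iff₀ hA0]
  exact h2

/-- **A uniform bound for the upper sums at `β = 1`**: for `y > 0`, any `z` and `N`,
`∑_{n ≤ N} T⁺_n(y, P(z)) ≤ 1 + V(P(min(z, √y)))⁻¹` ((4.6): for `√y ≤ z` only the primes below `√y` enter the sums
with `n ≥ 2` and `T⁺_1 = V(P(√y)) − V(P(z)) ≤ 1`; for `z < √y` the whole series is at most `V(P(z))⁻¹`).
[cite: IwaniecActaArith1980, (4.6)] -/
theorem discT_one_le_one_add_inv (hg : g.IsMultiplicative) (h01 : ∀ p : ℕ, p.Prime → 0 ≤ g p ∧ g p < 1)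
    {y : ℝ} (hy : 0 < y) (z : ℝ) (N : ℕ) :
    discT 1 g 1 y (primesProdBelow z) N ≤ 1 + (vprod g (primesProdBelow (min z (y ^ (1 / ((1:ℝ) + 1))))))⁻¹ := by
  have h01' : ∀ (w : ℝ), ∀ p ∈ (primesProdBelow w).primeFactors, 0 ≤ g p ∧ g p < 1 := fun w p hp =>
    h01 p (Nat.prime_of_mem_primeFactors hp)
  have hVpos : ∀ w : ℝ, 0 < vprod g (primesProdBelow w) := fun w =>
    Finset.prod_pos fun p hp => sub_pos.mpr (h01' w p hp).2
  have hVle1 : ∀ w : ℝ, vprod g (primesProdBelow w) ≤ 1 := fun w =>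
    Finset.prod_le_one (fun p hp => (sub_pos.mpr (h01' w p hp).2).le) fun p hp => by linarith [(h01' w p hp).1]
  set z₁ := y ^ (1 / ((1:ℝ) + 1)) with hz₁
  have hβ1 : (0:ℝ) < 1 + 1 := by norm_num
  rcases Nat.eq_zero_or_pos N with hN | hN
  · subst hN
    rw [discT_zero_right']
    have := (hVpos (min z z₁)).le
    positivity
  rcases le_or_gt z₁ z with hzz | hzz
  · rw [min_eq_right hzz, discT_one_eq_add hg hy.le hβ1 hzz hN, bdrySum_one_one_eq hy.le hβ1 hzz]
    have h1 : discT 1 g 1 y (primesProdBelow z₁) N ≤ (vprod g (primesProdBelow z₁))⁻¹ :=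
      discT_le_inv_vprod hg (squarefree_primesProdBelow _) (h01' z₁) 1 1 y N
    have h2 := hVle1 z₁
    have h3 := (hVpos z).le
    rw [← hz₁]
    linarith
  · rw [min_eq_left hzz.le]
    have h1 : discT 1 g 1 y (primesProdBelow z) N ≤ (vprod g (primesProdBelow z))⁻¹ :=
      discT_le_inv_vprod hg (squarefree_primesProdBelow _) (h01' z) 1 1 y N
    linarith

/-- **The inductive bound at small levels (`β = 1`), core**: for `1 < y < y₀` and `z ≥ 2` in the region
`(log y)^{19/20} ≤ log z`, if the boundary sums are at most `1 + M₁`, `M₁ = (log y₀/log 2)^κ (1 + L/log 2)`, then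
they satisfy the inductive bound with any amplitude `≥ 1` once `C` is large, because the main factor
`V s^{−κ} H(s) (log y)^{−3/8}` is bounded below (`V (log z)^κ ≥ (log 2)^κ/(1 + L/log 2)`, `s ≤ (log y₀)^{1/20}`).
[folklore] -/
theorem small_level_one (hκ : 0 < κ) (hdim : HasIwaniecDimension g κ L) {H : ℝ → ℝ} (hHpos : ∀ s, 0 < H s)
    (hHanti : Antitone H) {y₀ C : ℝ} (hC0 : 0 ≤ C)
    (hC : (1 + (Real.log y₀ / Real.log 2) ^ κ * (1 + L / Real.log 2)) * ((1 + L / Real.log 2) / Real.log 2 ^ κ) *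
      Real.log y₀ ^ κ * Real.log y₀ ^ ((3:ℝ) / 8) / H (Real.log y₀ ^ ((1:ℝ) / 20)) ≤ C)
    {amp : ℝ} (hamp : 1 ≤ amp) (par N : ℕ) {y z : ℝ} (hy1 : 1 < y) (hy : y < y₀) (hz : 2 ≤ z)
    (hsz : Real.log y ^ ((19:ℝ) / 20) ≤ Real.log z)
    (hD : discT par g 1 y (primesProdBelow z) N ≤ 1 + (Real.log y₀ / Real.log 2) ^ κ * (1 + L / Real.log 2)) :
    discT par g 1 y (primesProdBelow z) N ≤
      vprod g (primesProdBelow z) * (Real.log y / Real.log z) ^ (-κ) *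
        (contT par κ 1 N (Real.log y / Real.log z) + amp * C * H (Real.log y / Real.log z) * Real.log y ^ (-(3 / 8 : ℝ))) := by
  have hz1 : 1 < z := by linarith
  have hlogz : 0 < Real.log z := Real.log_pos hz1
  have hlog2 : 0 < Real.log 2 := Real.log_pos one_lt_two
  have hy0 : 0 < y := by linarith
  set ly := Real.log y with hly
  have hlypos : 0 < ly := Real.log_pos hy1
  have hly₀ : ly < Real.log y₀ := Real.log_lt_log hy0 hy
  have hly₀pos : 0 < Real.log y₀ := by linarith
  set s := ly / Real.log z with hsdef
  have hs0 : 0 < s := div_pos hlypos hlogz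
  have hL : 0 ≤ L := hdim.nonneg
  set A := 1 + L / Real.log 2 with hA
  have hA0 : 0 < A := by positivity
  set M₁ := (Real.log y₀ / Real.log 2) ^ κ * A with hM₁
  have hM₁0 : 0 ≤ M₁ := mul_nonneg (Real.rpow_nonneg (div_nonneg hly₀pos.le hlog2.le) _) hA0.le
  set V := vprod g (primesProdBelow z) with hVdef
  have hV : 0 < V := hdim.vprod_pos z
  have hl2κ : 0 < Real.log 2 ^ κ := Real.rpow_pos_of_pos hlog2 κ
  -- the lower bound for the main factor
  set sm := Real.log y₀ ^ ((1:ℝ) / 20) with hsm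
  have hss : s ≤ ly ^ ((1:ℝ) / 20) := by
    have h19 : 0 < ly ^ ((19:ℝ) / 20) := Real.rpow_pos_of_pos hlypos _
    have hmul : ly ^ ((1:ℝ) / 20) * ly ^ ((19:ℝ) / 20) = ly := by rw [← Real.rpow_add hlypos]; norm_num
    rw [hsdef, div_le_iff₀ hlogz]
    calc ly = ly ^ ((1:ℝ) / 20) * ly ^ ((19:ℝ) / 20) := hmul.symm
      _ ≤ ly ^ ((1:ℝ) / 20) * Real.log z := mul_le_mul_of_nonneg_left hsz (Real.rpow_nonneg hlypos.le _)
  have hssm : s ≤ sm := hss.trans (Real.rpow_le_rpow hlypos.le hly₀.le (by norm_num))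
  have h1 : Real.log y₀ ^ (-κ) ≤ ly ^ (-κ) := Real.rpow_le_rpow_of_nonpos hlypos hly₀.le (by linarith)
  have h2 : H sm ≤ H s := hHanti hssm
  have h3 : Real.log y₀ ^ (-(3 / 8 : ℝ)) ≤ ly ^ (-(3 / 8 : ℝ)) := Real.rpow_le_rpow_of_nonpos hlypos hly₀.le (by norm_num)
  have hVlow : Real.log 2 ^ κ / A ≤ V * Real.log z ^ κ := vprod_mul_log_rpow_ge hdim hz
  have hsκ : s ^ (-κ) = Real.log z ^ κ * ly ^ (-κ) := by rw [hsdef, div_rpow_neg_eq hlypos hlogz]; ring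
  have hcT0 : 0 ≤ contT par κ 1 N s := contT_nonneg hκ.le le_rfl par N hs0.le
  have hHsm := hHpos sm
  -- `1 + M₁ ≤ (log2^κ/A) ly₀^{-κ} · C · H(sm) · ly₀^{-3/8}` from `hC`
  have hkey : 1 + M₁ ≤ (Real.log 2 ^ κ / A) * Real.log y₀ ^ (-κ) * (1 * C * H sm * Real.log y₀ ^ (-(3 / 8 : ℝ))) := by
    rw [div_le_iff₀ hHsm] at hC
    have hlyκ : 0 < Real.log y₀ ^ κ := Real.rpow_pos_of_pos hly₀pos κ
    have hly38 : 0 < Real.log y₀ ^ ((3:ℝ) / 8) := Real.rpow_pos_of_pos hly₀pos _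
    rw [Real.rpow_neg hly₀pos.le, show (-(3 / 8 : ℝ)) = -((3:ℝ) / 8) by norm_num, Real.rpow_neg hly₀pos.le]
    rw [show Real.log 2 ^ κ / A * (Real.log y₀ ^ κ)⁻¹ * (1 * C * H sm * (Real.log y₀ ^ ((3:ℝ) / 8))⁻¹) =
      C * H sm * Real.log 2 ^ κ / (A * Real.log y₀ ^ κ * Real.log y₀ ^ ((3:ℝ) / 8)) by field_simp]
    rw [le_div_iff₀ (by positivity)]
    calc (1 + M₁) * (A * Real.log y₀ ^ κ * Real.log y₀ ^ ((3:ℝ) / 8))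
        = ((1 + M₁) * (A / Real.log 2 ^ κ) * Real.log y₀ ^ κ * Real.log y₀ ^ ((3:ℝ) / 8)) * Real.log 2 ^ κ := by
          field_simp
      _ ≤ (C * H sm) * Real.log 2 ^ κ := mul_le_mul_of_nonneg_right hC hl2κ.le
      _ = C * H sm * Real.log 2 ^ κ := by ring
  calc discT par g 1 y (primesProdBelow z) N ≤ 1 + M₁ := hD
    _ ≤ (Real.log 2 ^ κ / A) * Real.log y₀ ^ (-κ) * (1 * C * H sm * Real.log y₀ ^ (-(3 / 8 : ℝ))) := hkey
    _ ≤ (V * Real.log z ^ κ) * ly ^ (-κ) * (amp * C * H s * ly ^ (-(3 / 8 : ℝ))) := by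
        have := hHpos s
        refine mul_le_mul (mul_le_mul hVlow h1 (Real.rpow_nonneg hly₀pos.le _) (by positivity)) ?_ (by positivity)
          (by positivity)
        exact mul_le_mul (mul_le_mul (mul_le_mul_of_nonneg_right hamp hC0) h2 hHsm.le (by positivity))
          h3 (Real.rpow_nonneg hly₀pos.le _) (by positivity)
    _ = V * s ^ (-κ) * (amp * C * H s * ly ^ (-(3 / 8 : ℝ))) := by rw [hsκ]; ring
    _ ≤ V * s ^ (-κ) * (contT par κ 1 N s + amp * C * H s * ly ^ (-(3 / 8 : ℝ))) := by
        nlinarith [mul_nonneg (mul_nonneg hV.le (Real.rpow_nonneg hs0.le (-κ))) hcT0]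

/-- The crude bounds `≤ 1 + M₁` at small levels: lower parity with `z < y < y₀` (`∑ T_n ≤ V(P(z))⁻¹`), upper parity
with `y < y₀`, `y₀ ≥ 2` (`discT_one_le_one_add_inv`). [folklore] -/
theorem discT_small_le (hκ : 0 ≤ κ) (hg : g.IsMultiplicative) (hdim : HasIwaniecDimension g κ L) {y₀ y z : ℝ}
    (hy₀2 : 2 ≤ y₀) (hy0 : 0 < y) (hy : y < y₀) (hz : 2 ≤ z) (par : ℕ) (hpar : par = 1 ∨ z < y) (N : ℕ) :
    discT par g 1 y (primesProdBelow z) N ≤ 1 + (Real.log y₀ / Real.log 2) ^ κ * (1 + L / Real.log 2) := by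
  have hL : 0 ≤ L := hdim.nonneg
  have hlog2 : 0 < Real.log 2 := Real.log_pos one_lt_two
  have hly₀ : Real.log 2 ≤ Real.log y₀ := Real.log_le_log two_pos hy₀2
  set A := 1 + L / Real.log 2 with hA
  have hA1 : 1 ≤ A := by rw [hA]; linarith [div_nonneg hL hlog2.le]
  have hA0 : 0 < A := by linarith
  have hM₁1 : 1 ≤ (Real.log y₀ / Real.log 2) ^ κ * A := by
    have : 1 ≤ (Real.log y₀ / Real.log 2) ^ κ := Real.one_le_rpow (by rw [le_div_iff₀ hlog2]; linarith) hκ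
    nlinarith
  have hinvM : ∀ w : ℝ, 2 ≤ w → Real.log w ≤ Real.log y₀ →
      (vprod g (primesProdBelow w))⁻¹ ≤ (Real.log y₀ / Real.log 2) ^ κ * A := by
    intro w hw hlw
    refine (hdim.inv_vprod_le hw).trans ?_
    exact mul_le_mul_of_nonneg_right (Real.rpow_le_rpow (div_nonneg (Real.log_nonneg (by linarith)) hlog2.le)
      (div_le_div_of_nonneg_right hlw hlog2.le) hκ) hA0.le
  have h01 : ∀ p ∈ (primesProdBelow z).primeFactors, 0 ≤ g p ∧ g p < 1 := fun p hp =>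
    hdim.1 p (Nat.prime_of_mem_primeFactors hp)
  rcases hpar with hp1 | hzy
  · subst hp1
    refine (discT_one_le_one_add_inv hg hdim.1 hy0 z N).trans (add_le_add le_rfl ?_)
    set w := min z (y ^ (1 / ((1:ℝ) + 1))) with hw
    rcases le_or_gt 2 w with h2 | h2
    · refine hinvM w h2 ?_
      have hwle : w ≤ y ^ (1 / ((1:ℝ) + 1)) := min_le_right _ _
      have hw0 : 0 < w := by linarith
      calc Real.log w ≤ Real.log (y ^ (1 / ((1:ℝ) + 1))) := Real.log_le_log hw0 hwle
        _ = (1 / ((1:ℝ) + 1)) * Real.log y := Real.log_rpow hy0 _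
        _ ≤ Real.log y₀ := by
            have hly : Real.log y < Real.log y₀ := Real.log_lt_log hy0 hy
            have : 0 ≤ Real.log y₀ := by linarith
            by_cases hly0 : 0 ≤ Real.log y
            · nlinarith
            · push Not at hly0; nlinarith
    · rw [primesProdBelow_eq_one_of_le_two h2.le, vprod, Nat.primeFactors_one, Finset.prod_empty, inv_one]
      exact hM₁1
  · have hz0 : 0 < z := by linarith
    calc discT par g 1 y (primesProdBelow z) N ≤ (vprod g (primesProdBelow z))⁻¹ :=
          discT_le_inv_vprod hg (squarefree_primesProdBelow z) h01 par 1 y N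
      _ ≤ (Real.log y₀ / Real.log 2) ^ κ * A := hinvM z hz ((Real.log_lt_log hz0 (hzy.trans hy)).le)
      _ ≤ 1 + (Real.log y₀ / Real.log 2) ^ κ * A := by linarith

/-! ### Amplitudes and the induction at `β = 1` -/

/-- The amplitudes `A_N = 6N(1 + ε)^{2N}` of the induction at `β = 1`: `A_{N+1} ≥ 0`, `A_{N+2} ≥ 1`,
`3 + (1 + ε) A_{N+1} ≤ A_{N+2}` and `1 + (1 + ε)(2 + (1 + ε) A_{N+1}) ≤ A_{N+2}` (`0 ≤ ε ≤ 1/2`). [folklore] -/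
theorem amp_facts_one {ε : ℝ} (hε0 : 0 ≤ ε) (hε1 : ε ≤ 1 / 2) (N : ℕ) :
    0 ≤ 6 * ((N + 1 : ℕ) : ℝ) * (1 + ε) ^ (2 * (N + 1)) ∧
      1 ≤ 6 * ((N + 2 : ℕ) : ℝ) * (1 + ε) ^ (2 * (N + 2)) ∧
      3 + (1 + ε) * (6 * ((N + 1 : ℕ) : ℝ) * (1 + ε) ^ (2 * (N + 1))) ≤
        6 * ((N + 2 : ℕ) : ℝ) * (1 + ε) ^ (2 * (N + 2)) ∧
      1 + (1 + ε) * (2 + (1 + ε) * (6 * ((N + 1 : ℕ) : ℝ) * (1 + ε) ^ (2 * (N + 1)))) ≤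
        6 * ((N + 2 : ℕ) : ℝ) * (1 + ε) ^ (2 * (N + 2)) := by
  have h1 : (1:ℝ) ≤ 1 + ε := by linarith
  have hp : ∀ k : ℕ, (1:ℝ) ≤ (1 + ε) ^ k := fun k => one_le_pow₀ h1
  have hN0 : (0:ℝ) ≤ N := Nat.cast_nonneg N
  have e1 : (((N + 1 : ℕ) : ℝ)) = N + 1 := by push_cast; ring
  have e2 : (((N + 2 : ℕ) : ℝ)) = N + 2 := by push_cast; ring
  rw [e1, e2]
  have hpow : (1 + ε) ^ (2 * (N + 2)) = (1 + ε) ^ 2 * (1 + ε) ^ (2 * (N + 1)) := by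
    rw [← pow_add]; ring_nf
  set P := (1 + ε) ^ (2 * (N + 1)) with hP
  have hP1 : 1 ≤ P := hp _
  rw [hpow]
  have hsq : 1 ≤ (1 + ε) ^ 2 := hp 2
  have hsq' : (1 + ε) ^ 2 ≤ 9 / 4 := by nlinarith
  have hNP : 0 ≤ (N : ℝ) * ((1 + ε) ^ 2 * P) := mul_nonneg hN0 (by positivity)
  have hεP : 0 ≤ ε * P := mul_nonneg hε0 (by linarith)
  have hsqP : 1 ≤ (1 + ε) ^ 2 * P := by nlinarith
  refine ⟨by positivity, ?_, ?_, ?_⟩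
  · nlinarith
  · -- `3 + (1+ε) 6(N+1) P ≤ 6(N+2)(1+ε)² P`
    have hkey : 6 * ((N:ℝ) + 2) * ((1 + ε) ^ 2 * P) - (1 + ε) * (6 * ((N:ℝ) + 1) * P) =
        6 * ((N:ℝ) + 1) * P * (1 + ε) * ε + 6 * ((1 + ε) ^ 2 * P) := by ring
    have h6 : 0 ≤ 6 * ((N:ℝ) + 1) * P * (1 + ε) * ε := by positivity
    nlinarith
  · have hkey : 6 * ((N:ℝ) + 2) * ((1 + ε) ^ 2 * P) -
        (1 + (1 + ε) * (2 + (1 + ε) * (6 * ((N:ℝ) + 1) * P))) = 6 * ((1 + ε) ^ 2 * P) - 1 - 2 * (1 + ε) := by ring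
    nlinarith

end BetaSieve

end Literature.NumberTheory.Sieve

namespace Literature.NumberTheory.Sieve

namespace BetaSieve

open BetaSieveForward (sieveKernel sieveKernel_nonneg continuousOn_sieveKernel)

variable {g : ArithmeticFunction ℝ} {κ L : ℝ}

set_option maxHeartbeats 1600000 in
/-- **The induction on the number of boundary terms at `β = 1`** (Iwaniec, Lemma 20 for `κ ≤ 1/2`: (8.1) by
induction on `R`, here with the amplitudes `A_N = 6N(1 + ε)^{2N}`): under the hypotheses of the step theorems, for
every `N` both parities satisfy the inductive bound at all levels of the region `(log y)^{19/20} ≤ log z`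
(`z < y` for the lower parity, `1 < y` for the upper one). [cite: IwaniecActaArith1980, Lemma 20] -/
theorem claims_all_one {ε₁ R c₀ : ℝ} {Hp Hm : ℝ → ℝ}
    (hκ : 0 < κ) (hκ2 : κ ≤ 1 / 2) (hL : 0 ≤ L) (hε₁ : 0 ≤ ε₁) (hR : 0 ≤ R) (hc₀ : 0 ≤ c₀)
    (hHpos : ∀ s, 0 < Hp s ∧ 0 < Hm s) (hHp_anti : Antitone Hp) (hHm_anti : Antitone Hm)
    (hHp_cont : Continuous Hp) (hHm_cont : Continuous Hm)
    (hH1 : ∀ s U : ℝ, 1 < s → s ≤ U →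
      ∫ t in s..U, sieveKernel κ t * (1 - 1 / t) ^ (-(3 / 8 : ℝ)) * Hp (t - 1) ≤ (1 + ε₁) * Hm s)
    (hH2 : ∀ s U : ℝ, 2 ≤ s → s ≤ U →
      ∫ t in s..U, sieveKernel κ t * (1 - 1 / t) ^ (-(3 / 8 : ℝ)) * Hm (t - 1) ≤ (1 + ε₁) * Hp s)
    (hH3p : ∀ s, 1 ≤ s → Hp (s - 1) ≤ R * Hm s) (hH3m : ∀ s, 2 ≤ s → Hm (s - 1) ≤ R * Hp s)
    (hH4 : ∀ (N : ℕ) (u : ℝ), (1 ≤ u → contT 0 κ 1 N u ≤ c₀ * Hm u) ∧ (0 ≤ u → contT 1 κ 1 N u ≤ c₀ * Hp u))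
    (hH6 : ∀ s, Real.exp (-s) ≤ Hp s ∧ Real.exp (-s) ≤ Hm s)
    (hg : g.IsMultiplicative) (hdim : HasIwaniecDimension g κ L)
    {Ccr yc : ℝ} (hCcr : 0 ≤ Ccr)
    (hcrude : ∀ y : ℝ, yc ≤ y → ∀ (par N : ℕ),
      discT par g 1 y (primesProdBelow (Real.exp (Real.log y ^ ((19:ℝ) / 20)))) N ≤
        Ccr * vprod g (primesProdBelow (Real.exp (Real.log y ^ ((19:ℝ) / 20)))) *
          (Real.log y ^ ((1:ℝ) / 20)) ^ (-κ) * Real.exp (-(Real.log y ^ ((1:ℝ) / 20))) * Real.log y ^ (-(3 / 8 : ℝ)))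
    {C ε y₀ : ℝ} (hC1 : 1 ≤ C) (hC2 : Ccr * (1 + L) ≤ C)
    (hC3 : (Real.log 2 + 2 * L) * (1 + L / Real.log 2) / (Real.log 2 ^ κ * Hm 2) ≤ C)
    (hC4 : ((κ + 1) * L + 1) * R * c₀ * Real.log 2 ^ (-κ) ≤ C)
    (hC5 : (κ + 1) * L * (1 - 1 / (2:ℝ)) ^ (-κ - 3 / 8) * R * c₀ ≤ C)
    (hy₀c : yc ≤ y₀) (hy₀ : Real.exp (2 ^ 20) ≤ y₀)
    (hε : ε₁ + ((κ + 1) * L + 1) * R * Real.log 2 ^ (-κ - 3 / 8) * Real.log y₀ ^ (κ + 3 / 8 - 19 / 20) ≤ ε)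
    (hεh : ε₁ + (κ + 1) * L * (1 - 1 / (2:ℝ)) ^ (-κ - 3 / 8) * R * Real.log y₀ ^ (-((19:ℝ) / 20)) ≤ ε)
    (hε0 : 0 ≤ ε) (hε1 : ε ≤ 1 / 2)
    (hy₀6 : L * 2 ^ (κ + 1) * Real.log y₀ ^ ((3:ℝ) / 8 - 1) ≤ Hp 2 / 2)
    (hy₀7 : L * 2 * c₀ * Real.log y₀ ^ ((3:ℝ) / 8 - 1) ≤ 1 / 2)
    (hε4 : L * 2 / Real.log y₀ ≤ ε)
    (hCp : (1 + (Real.log y₀ / Real.log 2) ^ κ * (1 + L / Real.log 2)) * ((1 + L / Real.log 2) / Real.log 2 ^ κ) *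
      Real.log y₀ ^ κ * Real.log y₀ ^ ((3:ℝ) / 8) / Hp (Real.log y₀ ^ ((1:ℝ) / 20)) ≤ C)
    (hCm : (1 + (Real.log y₀ / Real.log 2) ^ κ * (1 + L / Real.log 2)) * ((1 + L / Real.log 2) / Real.log 2 ^ κ) *
      Real.log y₀ ^ κ * Real.log y₀ ^ ((3:ℝ) / 8) / Hm (Real.log y₀ ^ ((1:ℝ) / 20)) ≤ C) (N : ℕ) :
    (∀ y z : ℝ, 2 ≤ z → z < y → Real.log y ^ ((19:ℝ) / 20) ≤ Real.log z →
      discT 0 g 1 y (primesProdBelow z) N ≤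
        vprod g (primesProdBelow z) * (Real.log y / Real.log z) ^ (-κ) *
          (contT 0 κ 1 N (Real.log y / Real.log z) +
            (6 * (N : ℝ) * (1 + ε) ^ (2 * N)) * C * Hm (Real.log y / Real.log z) * Real.log y ^ (-(3 / 8 : ℝ)))) ∧
    (∀ y z : ℝ, 2 ≤ z → 1 < y → Real.log y ^ ((19:ℝ) / 20) ≤ Real.log z →
      discT 1 g 1 y (primesProdBelow z) N ≤
        vprod g (primesProdBelow z) * (Real.log y / Real.log z) ^ (-κ) *
          (contT 1 κ 1 N (Real.log y / Real.log z) +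
            (6 * (N : ℝ) * (1 + ε) ^ (2 * N)) * C * Hp (Real.log y / Real.log z) * Real.log y ^ (-(3 / 8 : ℝ)))) := by
  have hC0 : (0:ℝ) ≤ C := le_trans zero_le_one hC1
  have hβ1 : (0:ℝ) < 1 + 1 := by norm_num
  have hy₀2 : 2 ≤ y₀ := le_trans (by linarith [Real.add_one_le_exp ((2:ℝ) ^ 20), show (1:ℝ) ≤ 2 ^ 20 by norm_num]) hy₀
  -- general facts at an admissible level
  have hfacts : ∀ {y z : ℝ}, 2 ≤ z → 1 < y → 0 < Real.log y / Real.log z ∧ 0 ≤ vprod g (primesProdBelow z) := by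
    intro y z hz hy1
    have hz1 : 1 < z := by linarith
    exact ⟨div_pos (Real.log_pos hy1) (Real.log_pos hz1), (hdim.vprod_pos z).le⟩
  -- the small-level cases
  have hsmall0 : ∀ {y z : ℝ} {amp : ℝ} (N : ℕ), 1 ≤ amp → y < y₀ → 2 ≤ z → z < y →
      Real.log y ^ ((19:ℝ) / 20) ≤ Real.log z →
      discT 0 g 1 y (primesProdBelow z) N ≤
        vprod g (primesProdBelow z) * (Real.log y / Real.log z) ^ (-κ) *
          (contT 0 κ 1 N (Real.log y / Real.log z) + amp * C * Hm (Real.log y / Real.log z) * Real.log y ^ (-(3 / 8 : ℝ))) := by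
    intro y z amp N hamp hy hz hzy hsz
    have hy1 : 1 < y := by linarith
    exact small_level_one hκ hdim (fun s => (hHpos s).2) hHm_anti hC0 hCm hamp 0 N hy1 hy hz hsz
      (discT_small_le hκ.le hg hdim hy₀2 (by linarith) hy hz 0 (Or.inr hzy) N)
  have hsmall1 : ∀ {y z : ℝ} {amp : ℝ} (N : ℕ), 1 ≤ amp → y < y₀ → 2 ≤ z → 1 < y →
      Real.log y ^ ((19:ℝ) / 20) ≤ Real.log z →
      discT 1 g 1 y (primesProdBelow z) N ≤
        vprod g (primesProdBelow z) * (Real.log y / Real.log z) ^ (-κ) *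
          (contT 1 κ 1 N (Real.log y / Real.log z) + amp * C * Hp (Real.log y / Real.log z) * Real.log y ^ (-(3 / 8 : ℝ))) := by
    intro y z amp N hamp hy hz hy1 hsz
    exact small_level_one hκ hdim (fun s => (hHpos s).1) hHp_anti hC0 hCp hamp 1 N hy1 hy hz hsz
      (discT_small_le hκ.le hg hdim hy₀2 (by linarith) hy hz 1 (Or.inl rfl) N)
  -- nonnegativity of the right-hand side
  have hRHS : ∀ (par N : ℕ) {y z amp : ℝ} (H : ℝ → ℝ), (∀ s, 0 < H s) → 2 ≤ z → 1 < y → 0 ≤ amp →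
      0 ≤ vprod g (primesProdBelow z) * (Real.log y / Real.log z) ^ (-κ) *
        (contT par κ 1 N (Real.log y / Real.log z) + amp * C * H (Real.log y / Real.log z) * Real.log y ^ (-(3 / 8 : ℝ))) := by
    intro par N y z amp H hH hz hy1 hamp
    obtain ⟨hs0, hV0⟩ := hfacts hz hy1
    have := contT_nonneg hκ.le le_rfl par N hs0.le
    have := (hH (Real.log y / Real.log z)).le
    have := Real.rpow_nonneg (Real.log_pos hy1).le (-(3 / 8 : ℝ))
    have := Real.rpow_nonneg hs0.le (-κ)
    positivity
  have hy1_of_lt : ∀ {y z : ℝ}, 2 ≤ z → z < y → 1 < y := fun hz hzy => by linarith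
  have hy1_of_sq : ∀ {y z : ℝ}, 2 ≤ z → z ^ ((1:ℝ) + 1) ≤ y → 1 < y := by
    intro y z hz hzy
    have hz1 : (1:ℝ) < z := by linarith
    have : z < z ^ ((1:ℝ) + 1) := by
      calc z = z ^ (1:ℝ) := (Real.rpow_one z).symm
        _ < z ^ ((1:ℝ) + 1) := Real.rpow_lt_rpow_of_exponent_lt hz1 (by linarith)
    linarith
  -- two-step induction
  suffices H : ∀ N : ℕ,
      ((∀ y z : ℝ, 2 ≤ z → z < y → Real.log y ^ ((19:ℝ) / 20) ≤ Real.log z →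
        discT 0 g 1 y (primesProdBelow z) N ≤
          vprod g (primesProdBelow z) * (Real.log y / Real.log z) ^ (-κ) *
            (contT 0 κ 1 N (Real.log y / Real.log z) +
              (6 * (N : ℝ) * (1 + ε) ^ (2 * N)) * C * Hm (Real.log y / Real.log z) * Real.log y ^ (-(3 / 8 : ℝ)))) ∧
      (∀ y z : ℝ, 2 ≤ z → 1 < y → Real.log y ^ ((19:ℝ) / 20) ≤ Real.log z →
        discT 1 g 1 y (primesProdBelow z) N ≤
          vprod g (primesProdBelow z) * (Real.log y / Real.log z) ^ (-κ) *
            (contT 1 κ 1 N (Real.log y / Real.log z) +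
              (6 * (N : ℝ) * (1 + ε) ^ (2 * N)) * C * Hp (Real.log y / Real.log z) * Real.log y ^ (-(3 / 8 : ℝ))))) ∧
      ((∀ y z : ℝ, 2 ≤ z → z < y → Real.log y ^ ((19:ℝ) / 20) ≤ Real.log z →
        discT 0 g 1 y (primesProdBelow z) (N + 1) ≤
          vprod g (primesProdBelow z) * (Real.log y / Real.log z) ^ (-κ) *
            (contT 0 κ 1 (N + 1) (Real.log y / Real.log z) +
              (6 * ((N + 1 : ℕ) : ℝ) * (1 + ε) ^ (2 * (N + 1))) * C * Hm (Real.log y / Real.log z) *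
                Real.log y ^ (-(3 / 8 : ℝ)))) ∧
      (∀ y z : ℝ, 2 ≤ z → 1 < y → Real.log y ^ ((19:ℝ) / 20) ≤ Real.log z →
        discT 1 g 1 y (primesProdBelow z) (N + 1) ≤
          vprod g (primesProdBelow z) * (Real.log y / Real.log z) ^ (-κ) *
            (contT 1 κ 1 (N + 1) (Real.log y / Real.log z) +
              (6 * ((N + 1 : ℕ) : ℝ) * (1 + ε) ^ (2 * (N + 1))) * C * Hp (Real.log y / Real.log z) *
                Real.log y ^ (-(3 / 8 : ℝ))))) by
    exact (H N).1
  intro N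
  induction N with
  | zero =>
    refine ⟨⟨fun y z hz hzy hsz => ?_, fun y z hz hy1 hsz => ?_⟩, ⟨fun y z hz hzy hsz => ?_, fun y z hz hy1 hsz => ?_⟩⟩
    · rw [discT_zero_right']
      exact hRHS 0 0 Hm (fun s => (hHpos s).2) hz (hy1_of_lt hz hzy) (by norm_num)
    · rw [discT_zero_right']
      exact hRHS 1 0 Hp (fun s => (hHpos s).1) hz hy1 (by norm_num)
    · rw [discT_zero_one]
      exact hRHS 0 1 Hm (fun s => (hHpos s).2) hz (hy1_of_lt hz hzy) (by positivity)
    · -- `N = 1`, upper parity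
      have hamp1 : (1:ℝ) ≤ 6 * ((0 + 1 : ℕ) : ℝ) * (1 + ε) ^ (2 * (0 + 1)) := by
        norm_num; nlinarith
      by_cases hy : y₀ ≤ y
      · by_cases hhi : z ^ ((1:ℝ) + 1) ≤ y
        · rw [discT_one_one_eq_zero hβ1 hhi]
          exact hRHS 1 1 Hp (fun s => (hHpos s).1) hz hy1 (by positivity)
        · have hlow := step_one_low_one hκ hL hc₀ (fun s => (hHpos s).1) hHp_anti
            (fun N u hu => (hH4 N u).2 hu) hg hdim hC1 hε0 hy₀ hy₀6 hy₀7 hε4 (le_refl (0:ℝ)) (le_refl 1)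
            (fun y' z' _ hz' hzy' _ => by
              rw [discT_one_one_eq_zero hβ1 hzy']
              exact hRHS 1 1 Hp (fun s => (hHpos s).1) hz' (hy1_of_sq hz' hzy') le_rfl)
            y z hy hz hy1 (lt_of_not_ge hhi)
          obtain ⟨hs0, hV0⟩ := hfacts hz hy1
          exact bound_mono hV0 (Real.rpow_nonneg hs0.le _) hC0 (hHpos _).1.le
            (Real.rpow_nonneg (Real.log_pos hy1).le _) (by norm_num at hamp1 ⊢; nlinarith) hlow
      · exact hsmall1 1 hamp1 (lt_of_not_ge hy) hz hy1 hsz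
  | succ N ih =>
    obtain ⟨-, ih0, ih1⟩ := ih
    obtain ⟨hA0, hA1, hA2, hA3⟩ := amp_facts_one hε0 hε1 N
    have hA2' : 2 + (1 + ε) * (6 * ((N + 1 : ℕ) : ℝ) * (1 + ε) ^ (2 * (N + 1))) ≤
        6 * ((N + 2 : ℕ) : ℝ) * (1 + ε) ^ (2 * (N + 2)) := by linarith
    refine ⟨⟨ih0, ih1⟩, fun y z hz hzy hsz => ?_, fun y z hz hy1 hsz => ?_⟩
    · -- lower parity at `N + 2`
      rw [show N + 1 + 1 = N + 2 by ring]
      by_cases hy : y₀ ≤ y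
      · have h := step_zero_one hκ hκ2 hL hε₁ hR hc₀ hHpos hHp_anti hHm_anti hHp_cont hH1 hH3p
          (fun N u hu => (hH4 N u).2 hu) (fun s => (hH6 s).2) hg hdim hCcr hcrude hC1 hC2 hC3 hC4 hy₀c hy₀ hε
          hA0 ih1 y z hy hz hzy hsz
        obtain ⟨hs0, hV0⟩ := hfacts hz (hy1_of_lt hz hzy)
        exact bound_mono hV0 (Real.rpow_nonneg hs0.le _) hC0 (hHpos _).2.le
          (Real.rpow_nonneg (Real.log_pos (hy1_of_lt hz hzy)).le _) hA2 h
      · exact hsmall0 (N + 2) hA1 (lt_of_not_ge hy) hz hzy hsz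
    · -- upper parity at `N + 2`
      rw [show N + 1 + 1 = N + 2 by ring]
      have hhigh : ∀ y z : ℝ, y₀ ≤ y → 2 ≤ z → z ^ ((1:ℝ) + 1) ≤ y → Real.log y ^ ((19:ℝ) / 20) ≤ Real.log z →
          discT 1 g 1 y (primesProdBelow z) (N + 2) ≤
            vprod g (primesProdBelow z) * (Real.log y / Real.log z) ^ (-κ) *
              (contT 1 κ 1 (N + 2) (Real.log y / Real.log z) +
                (2 + (1 + ε) * (6 * ((N + 1 : ℕ) : ℝ) * (1 + ε) ^ (2 * (N + 1)))) * C *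
                  Hp (Real.log y / Real.log z) * Real.log y ^ (-(3 / 8 : ℝ))) :=
        step_one_high_one hκ hκ2 hL hR hc₀ hHpos hHm_anti hHm_cont hH2 hH3m
          (fun N u hu => (hH4 N u).1 hu) (fun s => (hH6 s).1) hg hdim hCcr hcrude hC1 hC2 hC5 hy₀c hy₀ hεh
          hA0 ih0
      by_cases hy : y₀ ≤ y
      · obtain ⟨hs0, hV0⟩ := hfacts hz hy1
        by_cases hhi : z ^ ((1:ℝ) + 1) ≤ y
        · exact bound_mono hV0 (Real.rpow_nonneg hs0.le _) hC0 (hHpos _).1.le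
            (Real.rpow_nonneg (Real.log_pos hy1).le _) hA2' (hhigh y z hy hz hhi hsz)
        · have hlow := step_one_low_one hκ hL hc₀ (fun s => (hHpos s).1) hHp_anti
            (fun N u hu => (hH4 N u).2 hu) hg hdim hC1 hε0 hy₀ hy₀6 hy₀7 hε4
            (by positivity : (0:ℝ) ≤ 2 + (1 + ε) * (6 * ((N + 1 : ℕ) : ℝ) * (1 + ε) ^ (2 * (N + 1))))
            (by omega : 1 ≤ N + 2) hhigh y z hy hz hy1 (lt_of_not_ge hhi)
          exact bound_mono hV0 (Real.rpow_nonneg hs0.le _) hC0 (hHpos _).1.le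
            (Real.rpow_nonneg (Real.log_pos hy1).le _) hA3 hlow
      · exact hsmall1 (N + 2) hA1 (lt_of_not_ge hy) hz hy1 hsz

end BetaSieve

end Literature.NumberTheory.Sieve
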